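import Summits.QuantumFields.YangMills.Theorems.LuscherReductionDressedRitzPolyakovLiftBasisGenericL
import Summits.QuantumFields.YangMills.Theorems.LuscherReductionDressedRitzPolyakovLiftTransplantRoot
import Summits.QuantumFields.YangMills.Theorems.LuscherReductionDressedRitzLiftLeakageKinematic
import HarnessLib

/-!
# Crux `DressedRitz` (stmt-QuantumFields-20205), idea «kick-dirichlet» rev 3 — MONOTONE DRESSING & THE DEFECT SANDWICH
# (crux-ideate #2, GEN 1–2): the variational halves of the dynamic clauses are dressing-free (§1–§6); the anti-variational half
# costs exactly the integrated leakage profile (§7–§8), which sharp-time spectral weights control (§9)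

KERNEL-CHECKED CONTENT (fixed lattice, every `β ≥ 0` resp. `β > 0`, every physical `u`):

* §1 `qform_mul_l2_le_dressed` — ONE-STEP MONOTONE DRESSING in product form, no positivity hypotheses:
  `⟨u, K_β u⟩ · ‖K_β u‖² ≤ ⟨K_β u, K_β K_β u⟩ · ‖u‖²`, i.e. the Rayleigh quotient `R(v) = ⟨v,K_βv⟩/‖v‖²` does not decrease under
  `u ↦ K_β u`.  Proof = the two Cauchy–Schwarz inequalities of the tree (`sq_l2_le`, `sq_qform_le`): with `Q = ⟨u,Ku⟩ = ⟨Ku,u⟩`,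
  `N' = ‖Ku‖² = ⟨Ku, K u⟩_K`, `Q² ≤ N'·N` and `N'² ≤ Q'·Q` multiply to `(QN')² ≤ (QN')(Q'N)` (this is the log-convexity of the moment
  sequence `m_t = ⟨u, K^t u⟩`; the tree proves the same step INSIDE `tendsto_rayleigh_slabGround` for the slabs `K^m 1` only).
* §2 `qform_mul_l2_le_iterate`, `rayleigh_le_rayleigh_iterate`, `rayleigh_iterate_monotone` — the iterated form: `m ↦ R(K_β^m u)` is
  monotone (`β > 0`, `‖u‖² > 0`, norms stay positive by the tree's `PolyakovLift.l2_iterate_self_pos`).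
* §3 clause transfers (pure real algebra on top of §2): the VARIATIONAL half of the Lüscher-position clause (o5)
  (`μ_{i+1}λ₀ n_i ≤ e^{Cλ²/L} d_ii μ₀`, "energies not too high") and the spread clause (o7) pass from ANY physical family `u` to the
  time-dressed family `K_β^m u` with the SAME constant, for EVERY `m`; the ANTI-VARIATIONAL half of (o5) (`d_ii μ₀ ≤ e^{Cλ²/L} μ_{i+1}λ₀ n_i`,
  "energies not too low") passes DOWNWARD in `m`.
* §4 the line of record: `positionVariational_dressedLiftFamily`, `spread_dressedLiftFamily` — for the lead's dressed family
  `dressedLiftFamily β φ g = K_β^{dressSteps L}(liftFamily β φ g)` (skeleton «polyakovlift» r3–r5) the variational half of (o5) and (o7) are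
  inherited from the SHARP-TIME lift `liftFamily β φ g`, whatever `dressSteps` is.
* §5 the reshape seam: `DirichletUpper` (= the UPPER Dirichlet band of `LiftPos.dirichletBand_of_position`, i.e. statement (V_i) of the card:
  an upper bound on the sharp one-step quadratic variation), ★★★ `positionVariational_dressed_of_sharp_dirichletUpper` (sharp upper band ⇒
  variational (o5) of the DRESSED family), `dynamicCoreClauses_dressed_of_halves` (sharp variational half + dressed anti-variational half + dressed
  (o6) ⇒ `DynamicCoreClauses` of the dressed family — the two-halves variant of the composition the card proposes).
* §6 the WINDOW-LEVEL seam for the skeleton of record: `ChannelUniversalityVarAt k` (SHARP-TIME variational half of r5's `ChannelUniversalityAt k`: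
  the second (A5) conjunct with the UNDRESSED lift on the fine side, norms positive), `ChannelUniversalityAntiVarAt k` (first (A5) conjunct + (A6′)
  for the dressed family, verbatim), ★★★ `channelUniversalityAt_of_halves : VarAt k → AntiVarAt k → ChannelUniversalityAt k` (constants `C_var + C_anti`)
  and `liftPositionR3_of_halves_pscalingExists` — i.e. `stub_universality` splits BY NAME into a `t ∈ {0,1}` kick-currency stub and a spectral stub.
* §7 (rev 3) ★★ the DEFECT SANDWICH `sandwich_upper` ∕ `sandwich_lower` (product forms, null vectors included) and its ratio forms
  `rayleigh_step_ge` ∕ `rayleigh_step_le`:  `R(w)·δ(w) ≤ R(K_βw) − R(w) ≤ 2λ₀·δ(w)`, `δ(w) = 1 − ⟨w,K_βw⟩²/(‖w‖²‖K_βw‖²)` the NORMALISED one-step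
  leakage defect (test vector `z = K_βw − R(w)•w`: top of the spectrum for the upper, `⟨z,K_βz⟩ ≥ 0` for the lower); telescoped along the dressing,
  ★★★ `rayleigh_iterate_le_add_defectSum` ∕ `rayleigh_mul_one_add_defectSum_le`:  `R(v)(1 + Σ_{s<m}δ(K^s v)) ≤ R(K^m v) ≤ R(v) + 2λ₀Σ_{s<m}δ(K^s v)`.
  So the dressing raises the Rayleigh quotient by EXACTLY the integrated leakage profile `defectSum`, within the factor `2λ₀/R ≈ 2`.
* §8 (rev 3) seams: `DefectSumSmall` (μ-currency) ∕ `DefectSumAt k` (window level), ★★★ `positionAntiVariational_dressed_of_sharp_defectSum` (SHARP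
  anti-variational half + small profile ⇒ DRESSED anti-variational half, constants `C_A + 2C_D`), `dynamicCoreClauses_dressed_of_sharp`, the window
  statements `ChannelUniversalitySharpAt k` (TWO-SIDED sharp kick statistic), `CouplingUniversalityAt k` ((A6′) verbatim) and
  ★★★ `channelUniversalityAt_of_sharp_defectSum_coupling : SharpAt k → DefectSumAt k → CouplingUniversalityAt k → ChannelUniversalityAt k` (by NAME the
  body of r5's `stub_universality`); the converse bookkeeping `one_add_defectSum_le_of_twoSided` (two-sided dressed (A5) + sharp variational half
  FORCE `defectSum ≤ e^{(C_A+C_V)λ²/L} − 1`: the split is lossless).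
* §9 (rev 3) the profile from SHARP-TIME SPECTRAL WEIGHTS: `defect_le_residual_div` (δ ≤ any relative squared residual), ★★★ `defectSum_le_of_sharp_weights`
  (s1's kinematic lever cut `LiftLeak.residual_iterate_le_kinematic`, support XIV, summed over the depths with `Σ1/(s+1)² ≤ 2`):
  `defectSum β x m ≤ m·A·Σ_{S}(ev_j−μ)²w_j/(μ²w_{j₀}) + 2(‖x‖² − Σ_S w_j)/w_{j₀}` and its window currency `defectSum_le_of_tower_hard`
  (`≤ (A·D²·C_t + 2C_h)·m r²`, `m r² = Λ²/L` at `m = L`, `r = Λ/L`): the hard sector costs twice its sharp-time RELATIVE WEIGHT along the whole dressing.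
* §10 (rev 3) the same window seams PARAMETRIC in the basis predicate `P L Λ g` of skeleton r6 (registered 2026-08-27T18:29Z; `…PolyakovLiftBasisGenericL`):
  `ChannelUniversalitySharpForL P`, `DefectSumForL P`, `CouplingUniversalityForL P`, ★★★ `channelUniversalityForL_of_sharp_defectSum_coupling (hP : BasisPhysL P)`
  and ★★ `stub_universality_of_sharp_defectSum_coupling` — at `P := TransplantBasisL k` the conclusion `∀ k, ChannelUniversalityForL (TransplantBasisL k)` is r6's
  registered `stub_universality` text verbatim.

WHY IT MATTERS FOR THE CRUX (card `Cruxes/DressedRitz/Ideas/kick-dirichlet.md`, rev 2): the sharp-time currency of the card (one-step increment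
form = `LiftPos.dirichlet_identity`, conditional kick form KICK, single-slice marginal MARG — all `t ∈ {0,1}` vacuum correlators) was stranded by
the lead's time-dressing reshape (r3: `u_i' = K^L u_i`, forced by the UV hazard on the leakage clause (o4) ONLY).  This file shows the reshape costs
the sharp-time programme NOTHING on the variational side: every UPPER bound on sharp-time Dirichlet energies of the lifted one-site eigenfunctions
is an upper bound on the dressed energies of record.  Rev 3 closes the other side: the anti-variational half of (o5) ∕ (A5) for the dressed
family is EQUIVALENT (given the variational half) to the anti-variational half for the SHARP lift plus an `O(λ²/L)` bound on the integrated leakage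
profile — so ALL the one-loop precision of S-UNIV′ sits in a TWO-SIDED `t ∈ {0,1}` vacuum statistic of the flowed-Polyakov insertions (kick ∕ Dirichlet
∕ single-slice-marginal currency), while the `t ≥ 2` inputs (profile, (o4), (o6)) are of power-counting grade; and the profile itself is bounded by
sharp-time spectral weights (tower weight × lever², hard weight × 2) through s1's kinematic cut, with the hard weight needed at its true size
`O(λ⁴/L)` (cdisprove (G1-d′)).  What genuinely needs Euclidean time `≍ L` is only the LOCATION of true spectral weight to that coarse precision.
HONEST FRAMING: fixed-lattice operator algebra; no renormalisation-group content; bears on the femto rung R2b1 only; nothing here concerns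
infinite volume, the continuum limit or the Clay mass gap.
References: M. Reed, B. Simon IV (1978) Thm XIII.1 (min–max, moment inequalities); M. Lüscher, U. Wolff, NPB 339 (1990) 222 (time-dressed
correlators / GEVP); M. Lüscher, CMP 54 (1977) 283 §3 (positivity of the transfer matrix); T. Kato, J. Phys. Soc. Japan 4 (1949) 334 §1
(residual bounds); M. Lüscher, NPB 219 (1983) 233 §3 (femto-universe effective Hamiltonian).
-/

set_option autoImplicit false

noncomputable section

open MeasureTheory Real
open scoped BigOperators
open Literature.MathematicalPhysics.QuantumFieldTheory (GaugeConfig)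

namespace Summit.QuantumFields.YangMills.Cruxes.DressedRitz.KickDirichlet

open Summit.QuantumFields.YangMills.Theorems.FemtoTransferGap
open Summit.QuantumFields.YangMills.Theorems.FemtoTransferGap.PolyakovLift

variable {L : ℕ} [NeZero L]

/-! ## §1 One-step monotone dressing -/

/-- **Monotone dressing, one step, product form**: `⟨u,K_βu⟩·‖K_βu‖² ≤ ⟨K_βu, K_βK_βu⟩·‖u‖²` for every physical `u` and `β ≥ 0`
(log-convexity of `t ↦ ⟨u, K_β^t u⟩`: the two Cauchy–Schwarz inequalities). [cite: ReedSimonIV1978, Thm. XIII.1] -/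
theorem qform_mul_l2_le_dressed {β : ℝ} (hβ : 0 ≤ β) {u : GaugeConfig 3 L SU2 → ℝ} (hu : IsPhys u) :
    qform su2Rep β u u * l2 (transferApply β u) (transferApply β u) ≤
      qform su2Rep β (transferApply β u) (transferApply β u) * l2 u u := by
  have hvP : IsPhys (transferApply (L := L) β u) := isPhys_transferApply β hu
  -- `Q = ⟨Ku, u⟩`, `N' = ⟨Ku, Ku⟩ = qform (Ku) u`
  have hQ : qform su2Rep β u u = l2 (transferApply β u) u := (l2_transferApply_left β u u).symm
  have hN' : l2 (transferApply β u) (transferApply β u) = qform su2Rep β (transferApply β u) u :=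
    l2_transferApply_left β u (transferApply β u)
  have h1 : l2 (transferApply β u) u ^ 2 ≤ l2 (transferApply β u) (transferApply β u) * l2 u u := sq_l2_le hvP hu
  have h2 : qform su2Rep β (transferApply β u) u ^ 2 ≤
      qform su2Rep β (transferApply β u) (transferApply β u) * qform su2Rep β u u := sq_qform_le hβ hvP hu
  rw [← hQ] at h1
  rw [← hN'] at h2
  have hQnn : 0 ≤ qform su2Rep β u u := qform_su2Rep_self_nonneg hβ hu
  have hQ'nn : 0 ≤ qform su2Rep β (transferApply β u) (transferApply β u) := qform_su2Rep_self_nonneg hβ hvP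
  have hNnn : 0 ≤ l2 u u := l2_self_nonneg u
  have hN'nn : 0 ≤ l2 (transferApply β u) (transferApply β u) := l2_self_nonneg _
  rcases (mul_nonneg hQnn hN'nn).eq_or_lt with h0 | hpos
  · rw [← h0]; exact mul_nonneg hQ'nn hNnn
  · have hXY : (qform su2Rep β u u * l2 (transferApply β u) (transferApply β u)) *
        (qform su2Rep β u u * l2 (transferApply β u) (transferApply β u)) ≤
        (qform su2Rep β u u * l2 (transferApply β u) (transferApply β u)) *
          (qform su2Rep β (transferApply β u) (transferApply β u) * l2 u u) := by
      calc _ = qform su2Rep β u u ^ 2 * l2 (transferApply β u) (transferApply β u) ^ 2 := by ring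
        _ ≤ (l2 (transferApply β u) (transferApply β u) * l2 u u) *
            (qform su2Rep β (transferApply β u) (transferApply β u) * qform su2Rep β u u) :=
            mul_le_mul h1 h2 (sq_nonneg _) (mul_nonneg hN'nn hNnn)
        _ = _ := by ring
    exact le_of_mul_le_mul_left hXY hpos

/-! ## §2 Iterated dressing -/

/-- **Monotone dressing, `m` steps, product form**: `⟨u,K u⟩·‖K^m u‖² ≤ ⟨K^m u, K^{m+1} u⟩·‖u‖²` (`β > 0`, `‖u‖² > 0`).
[cite: ReedSimonIV1978, Thm. XIII.1] -/
theorem qform_mul_l2_le_iterate {β : ℝ} (hβ : 0 < β) {u : GaugeConfig 3 L SU2 → ℝ} (hu : IsPhys u) (hpos : 0 < l2 u u) (m : ℕ) :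
    qform su2Rep β u u * l2 ((transferApply (L := L) β)^[m] u) ((transferApply β)^[m] u) ≤
      qform su2Rep β ((transferApply (L := L) β)^[m] u) ((transferApply β)^[m] u) * l2 u u := by
  induction m with
  | zero => simp
  | succ m ih =>
    set w : GaugeConfig 3 L SU2 → ℝ := (transferApply (L := L) β)^[m] u with hw
    have hwP : IsPhys w := isPhys_iterate_transferApply β hu m
    have hwpos : 0 < l2 w w := l2_iterate_self_pos hβ hu hpos m
    have hstep := qform_mul_l2_le_dressed hβ.le hwP
    rw [Function.iterate_succ_apply', ← hw]
    -- `Q₀ N_m ≤ Q_m N₀` (ih) and `Q_m N_{m+1} ≤ Q_{m+1} N_m` (step) ⇒ `Q₀ N_{m+1} ≤ Q_{m+1} N₀`, dividing by `N_m > 0`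
    have hN1 : 0 ≤ l2 (transferApply β w) (transferApply β w) := l2_self_nonneg _
    have hN0 : 0 ≤ l2 u u := hpos.le
    have key : l2 w w * (qform su2Rep β u u * l2 (transferApply β w) (transferApply β w)) ≤
        l2 w w * (qform su2Rep β (transferApply β w) (transferApply β w) * l2 u u) := by
      calc l2 w w * (qform su2Rep β u u * l2 (transferApply β w) (transferApply β w))
          = (qform su2Rep β u u * l2 w w) * l2 (transferApply β w) (transferApply β w) := by ring
        _ ≤ (qform su2Rep β w w * l2 u u) * l2 (transferApply β w) (transferApply β w) :=
            mul_le_mul_of_nonneg_right ih hN1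
        _ = (qform su2Rep β w w * l2 (transferApply β w) (transferApply β w)) * l2 u u := by ring
        _ ≤ (qform su2Rep β (transferApply β w) (transferApply β w) * l2 w w) * l2 u u :=
            mul_le_mul_of_nonneg_right hstep hN0
        _ = l2 w w * (qform su2Rep β (transferApply β w) (transferApply β w) * l2 u u) := by ring
    exact le_of_mul_le_mul_left key hwpos

/-- **Rayleigh quotients do not decrease under dressing**: `R(u) ≤ R(K_β^m u)`. [cite: ReedSimonIV1978, Thm. XIII.1] -/
theorem rayleigh_le_rayleigh_iterate {β : ℝ} (hβ : 0 < β) {u : GaugeConfig 3 L SU2 → ℝ} (hu : IsPhys u) (hpos : 0 < l2 u u) (m : ℕ) :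
    qform su2Rep β u u / l2 u u ≤
      qform su2Rep β ((transferApply (L := L) β)^[m] u) ((transferApply β)^[m] u) /
        l2 ((transferApply (L := L) β)^[m] u) ((transferApply β)^[m] u) := by
  rw [div_le_div_iff₀ hpos (l2_iterate_self_pos hβ hu hpos m)]
  exact qform_mul_l2_le_iterate hβ hu hpos m

/-- **`m ↦ R(K_β^m u)` is monotone.** [cite: ReedSimonIV1978, Thm. XIII.1] -/
theorem rayleigh_iterate_monotone {β : ℝ} (hβ : 0 < β) {u : GaugeConfig 3 L SU2 → ℝ} (hu : IsPhys u) (hpos : 0 < l2 u u) :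
    Monotone (fun m : ℕ => qform su2Rep β ((transferApply (L := L) β)^[m] u) ((transferApply β)^[m] u) /
      l2 ((transferApply (L := L) β)^[m] u) ((transferApply β)^[m] u)) := by
  refine monotone_nat_of_le_succ fun m => ?_
  have h := rayleigh_le_rayleigh_iterate hβ (isPhys_iterate_transferApply β hu m) (l2_iterate_self_pos hβ hu hpos m) 1
  simp only [Function.iterate_one] at h
  simpa only [Function.iterate_succ_apply'] using h

/-! ## §3 Clause transfers (real algebra) -/

/-- Transfer of a VARIATIONAL inequality `a·n ≤ E·(d·b)` along `d·n' ≤ d'·n` (`n > 0`, `n', E, b ≥ 0`). [folklore] -/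
theorem variational_transfer {a b E n n' d d' : ℝ} (hn : 0 < n) (hn' : 0 ≤ n') (hE : 0 ≤ E) (hb : 0 ≤ b)
    (hmono : d * n' ≤ d' * n) (h : a * n ≤ E * (d * b)) : a * n' ≤ E * (d' * b) := by
  have h1 : a * n * n' ≤ E * (d * b) * n' := mul_le_mul_of_nonneg_right h hn'
  have h2 : E * b * (d * n') ≤ E * b * (d' * n) := mul_le_mul_of_nonneg_left hmono (mul_nonneg hE hb)
  have h3 : n * (a * n') ≤ n * (E * (d' * b)) := by
    calc n * (a * n') = a * n * n' := by ring
      _ ≤ E * (d * b) * n' := h1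
      _ = E * b * (d * n') := by ring
      _ ≤ E * b * (d' * n) := h2
      _ = n * (E * (d' * b)) := by ring
  exact le_of_mul_le_mul_left h3 hn

/-- Transfer of a SPREAD inequality `λ₀·n − d ≤ c·n` along `d·n' ≤ d'·n` (`n > 0`, `n' ≥ 0`). [folklore] -/
theorem spread_transfer {lam0 c n n' d d' : ℝ} (hn : 0 < n) (hn' : 0 ≤ n') (hmono : d * n' ≤ d' * n)
    (h : lam0 * n - d ≤ c * n) : lam0 * n' - d' ≤ c * n' := by
  have h1 : (lam0 - c) * n ≤ d := by linarith
  have h2 : (lam0 - c) * n * n' ≤ d * n' := mul_le_mul_of_nonneg_right h1 hn'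
  have h3 : n * ((lam0 - c) * n') ≤ n * d' := by
    calc n * ((lam0 - c) * n') = (lam0 - c) * n * n' := by ring
      _ ≤ d * n' := h2
      _ ≤ d' * n := hmono
      _ = n * d' := by ring
  have h4 := le_of_mul_le_mul_left h3 hn
  linarith

/-- The VARIATIONAL half of the Lüscher-position clause (o5) of `PolyakovLift.DynamicCoreClauses` ("energies not too high"):
`μ_{i+1}(B)·λ₀·n_i ≤ e^{Cλ²/L}·(d_ii·μ₀(B))`, `B = oneSiteCoupling β L`. [cite: Luscher1983, §3] -/
def PositionVariational (k : ℕ) (C : ℝ) (β : ℝ) (u : Fin k → (GaugeConfig 3 L SU2 → ℝ)) : Prop :=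
  ∀ i : Fin k,
    levelValue su2Rep 1 (oneSiteCoupling β L) ((i : ℕ) + 1) * levelValue su2Rep L β 0 * l2 (u i) (u i) ≤
      Real.exp (C * luscherLambda β L ^ 2 / L) *
        (l2 (u i) (transferApply β (u i)) * levelValue su2Rep 1 (oneSiteCoupling β L) 0)

/-- The ANTI-VARIATIONAL half of (o5) ("energies not too low"): `d_ii·μ₀(B) ≤ e^{Cλ²/L}·(μ_{i+1}(B)·λ₀)·n_i`. [cite: Luscher1983, §3] -/
def PositionAntiVariational (k : ℕ) (C : ℝ) (β : ℝ) (u : Fin k → (GaugeConfig 3 L SU2 → ℝ)) : Prop :=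
  ∀ i : Fin k,
    l2 (u i) (transferApply β (u i)) * levelValue su2Rep 1 (oneSiteCoupling β L) 0 ≤
      Real.exp (C * luscherLambda β L ^ 2 / L) *
        (levelValue su2Rep 1 (oneSiteCoupling β L) ((i : ℕ) + 1) * levelValue su2Rep L β 0) * l2 (u i) (u i)

/-- The spread clause (o7) of `PolyakovLift.DynamicClauses`: `λ₀ n_i − d_ii ≤ C(λ/L)λ₀ n_i`. [cite: Luscher1983, §3] -/
def Spread (k : ℕ) (C : ℝ) (β : ℝ) (u : Fin k → (GaugeConfig 3 L SU2 → ℝ)) : Prop :=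
  ∀ i : Fin k, levelValue su2Rep L β 0 * l2 (u i) (u i) - l2 (u i) (transferApply β (u i))
      ≤ C * (luscherLambda β L / L) * levelValue su2Rep L β 0 * l2 (u i) (u i)

/-- (o5) of `DynamicCoreClauses` is `PositionAntiVariational ∧ PositionVariational` (bookkeeping). [folklore] -/
theorem position_of_dynamicCoreClauses {k : ℕ} {C β : ℝ} {u : Fin k → (GaugeConfig 3 L SU2 → ℝ)}
    (h : DynamicCoreClauses k C β u) : PositionAntiVariational k C β u ∧ PositionVariational k C β u :=
  ⟨fun i => (h.1 i).1, fun i => (h.1 i).2⟩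

/-- Conversely the two halves and (o6) reassemble `DynamicCoreClauses` (bookkeeping). [folklore] -/
theorem dynamicCoreClauses_of_position {k : ℕ} {C β : ℝ} {u : Fin k → (GaugeConfig 3 L SU2 → ℝ)}
    (ha : PositionAntiVariational k C β u) (hv : PositionVariational k C β u)
    (hcoup : ∀ i l : Fin k, i ≠ l →
      |l2 (u i) (transferApply β (u l)) -
          (l2 (u i) (transferApply β (u i)) / l2 (u i) (u i) + l2 (u l) (transferApply β (u l)) / l2 (u l) (u l)) / 2 *
            l2 (u i) (u l)|
        ≤ C * (luscherLambda β L ^ 2 / L) * levelValue su2Rep L β 0 *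
            (Real.sqrt (l2 (u i) (u i)) * Real.sqrt (l2 (u l) (u l)))) :
    DynamicCoreClauses k C β u :=
  ⟨fun i => ⟨ha i, hv i⟩, hcoup⟩

omit [NeZero L] in
/-- `0 ≤ μ₀(B)` at the one-site coupling `B = oneSiteCoupling β L = 2L³/λ³ ≥ 0` (λ is a real power of a `max _ 0`). [folklore] -/
theorem levelValue_oneSiteCoupling_zero_nonneg (β : ℝ) : 0 ≤ levelValue su2Rep 1 (oneSiteCoupling β L) 0 := by
  have hlam : 0 ≤ luscherLambda β L := by
    unfold luscherLambda; exact Real.rpow_nonneg (le_max_right _ _) _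
  have hB : 0 ≤ oneSiteCoupling β L := by
    unfold oneSiteCoupling; positivity
  exact levelValue_nonneg_of_qform_nonneg su2Rep (oneSiteCoupling β L) (fun ψ hψ => qform_su2Rep_self_nonneg hB hψ) 0

/-- The monotone-dressing inequality in the clauses' currency `d = ⟨u, K u⟩`, `n = ‖u‖²`: `d·n' ≤ d'·n` for `u' = K^m u`. [folklore] -/
theorem d_mul_n_le_iterate {β : ℝ} (hβ : 0 < β) {u : GaugeConfig 3 L SU2 → ℝ} (hu : IsPhys u) (hpos : 0 < l2 u u) (m : ℕ) :
    l2 u (transferApply β u) * l2 ((transferApply (L := L) β)^[m] u) ((transferApply β)^[m] u) ≤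
      l2 ((transferApply (L := L) β)^[m] u) (transferApply β ((transferApply β)^[m] u)) * l2 u u := by
  simpa only [qform_eq_l2_transferApply] using qform_mul_l2_le_iterate hβ hu hpos m

/-- ★ **The variational half of (o5) is dressing-free**: it passes from any physical family with positive norms to its `m`-fold time dressing,
same constant. [cite: LuscherWolff1990] -/
theorem positionVariational_iterate {k : ℕ} {C β : ℝ} (hβ : 0 < β) {u : Fin k → (GaugeConfig 3 L SU2 → ℝ)}
    (hu : ∀ i, IsPhys (u i)) (hn : ∀ i, 0 < l2 (u i) (u i)) (m : ℕ) (h : PositionVariational k C β u) :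
    PositionVariational k C β (fun i => (transferApply (L := L) β)^[m] (u i)) := by
  intro i
  exact variational_transfer (hn i) (l2_self_nonneg _) (Real.exp_nonneg _) (levelValue_oneSiteCoupling_zero_nonneg β)
    (d_mul_n_le_iterate hβ (hu i) (hn i) m) (h i)

/-- ★ **The spread clause (o7) is dressing-free.** [cite: LuscherWolff1990] -/
theorem spread_iterate {k : ℕ} {C β : ℝ} (hβ : 0 < β) {u : Fin k → (GaugeConfig 3 L SU2 → ℝ)}
    (hu : ∀ i, IsPhys (u i)) (hn : ∀ i, 0 < l2 (u i) (u i)) (m : ℕ) (h : Spread k C β u) :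
    Spread k C β (fun i => (transferApply (L := L) β)^[m] (u i)) := by
  intro i
  exact spread_transfer (hn i) (l2_self_nonneg _) (d_mul_n_le_iterate hβ (hu i) (hn i) m) (h i)

/-- ★ **The anti-variational half of (o5) passes DOWNWARD in the dressing depth**: if it holds for `K^{m+j} u` it holds for `K^m u`.
[cite: LuscherWolff1990] -/
theorem positionAntiVariational_of_deeper {k : ℕ} {C β : ℝ} (hβ : 0 < β) {u : Fin k → (GaugeConfig 3 L SU2 → ℝ)}
    (hu : ∀ i, IsPhys (u i)) (hn : ∀ i, 0 < l2 (u i) (u i)) (m j : ℕ)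
    (h : PositionAntiVariational k C β (fun i => (transferApply (L := L) β)^[m + j] (u i))) :
    PositionAntiVariational k C β (fun i => (transferApply (L := L) β)^[m] (u i)) := by
  intro i
  set w : GaugeConfig 3 L SU2 → ℝ := (transferApply (L := L) β)^[m] (u i) with hw
  set w' : GaugeConfig 3 L SU2 → ℝ := (transferApply (L := L) β)^[m + j] (u i) with hw'
  have hwP : IsPhys w := isPhys_iterate_transferApply β (hu i) m
  have hwpos : 0 < l2 w w := l2_iterate_self_pos hβ (hu i) (hn i) m
  have hw'pos : 0 < l2 w' w' := l2_iterate_self_pos hβ (hu i) (hn i) (m + j)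
  have hj : (transferApply (L := L) β)^[j] w = w' := by
    rw [hw, hw', ← Function.iterate_add_apply, Nat.add_comm]
  have hmono := d_mul_n_le_iterate hβ hwP hwpos j
  rw [hj] at hmono
  -- `hmono : d_w · n' ≤ d' · n_w`, `h i : d' · μ₀ ≤ E · (μλ₀) · n'`; conclude `d_w · μ₀ ≤ E · (μλ₀) · n_w` dividing by `n' > 0`
  have hi : l2 w' (transferApply β w') * levelValue su2Rep 1 (oneSiteCoupling β L) 0 ≤
      Real.exp (C * luscherLambda β L ^ 2 / L) *
        (levelValue su2Rep 1 (oneSiteCoupling β L) ((i : ℕ) + 1) * levelValue su2Rep L β 0) * l2 w' w' := h i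
  have hμ₀ := levelValue_oneSiteCoupling_zero_nonneg (L := L) β
  set E : ℝ := Real.exp (C * luscherLambda β L ^ 2 / L) *
    (levelValue su2Rep 1 (oneSiteCoupling β L) ((i : ℕ) + 1) * levelValue su2Rep L β 0) with hE
  show l2 w (transferApply β w) * levelValue su2Rep 1 (oneSiteCoupling β L) 0 ≤ E * l2 w w
  have key : l2 w' w' * (l2 w (transferApply β w) * levelValue su2Rep 1 (oneSiteCoupling β L) 0) ≤
      l2 w' w' * (E * l2 w w) := by
    calc l2 w' w' * (l2 w (transferApply β w) * levelValue su2Rep 1 (oneSiteCoupling β L) 0)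
        = (l2 w (transferApply β w) * l2 w' w') * levelValue su2Rep 1 (oneSiteCoupling β L) 0 := by ring
      _ ≤ (l2 w' (transferApply β w') * l2 w w) * levelValue su2Rep 1 (oneSiteCoupling β L) 0 :=
          mul_le_mul_of_nonneg_right hmono hμ₀
      _ = (l2 w' (transferApply β w') * levelValue su2Rep 1 (oneSiteCoupling β L) 0) * l2 w w := by ring
      _ ≤ (E * l2 w' w') * l2 w w := mul_le_mul_of_nonneg_right hi hwpos.le
      _ = l2 w' w' * (E * l2 w w) := by ring
  exact le_of_mul_le_mul_left key hw'pos

/-! ## §4 The line of record («polyakovlift» r3–r5): sharp lift ⇒ dressed lift on the variational side -/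

/-- ★★ **Variational half of (o5) for the DRESSED family of record from the SHARP-TIME lift**, any `dressSteps`. [cite: LuscherWolff1990] -/
theorem positionVariational_dressedLiftFamily {k : ℕ} {C β : ℝ} (hβ : 0 < β) {φ : GaugeConfig 3 L SU2 → ℝ} (hφ : IsPhys φ)
    {g : Fin k → (GaugeConfig 3 1 SU2 → ℝ)} (hg : ∀ i, IsPhys (g i))
    (hn : ∀ i, 0 < l2 (liftFamily β φ g i) (liftFamily β φ g i)) (h : PositionVariational k C β (liftFamily β φ g)) :
    PositionVariational k C β (dressedLiftFamily β φ g) := by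
  have := positionVariational_iterate hβ (fun i => isPhys_liftVec β hφ (hg i)) hn (dressSteps L) h
  intro i
  simpa only [dressedLiftFamily_apply] using this i

/-- ★★ **Spread (o7) for the DRESSED family of record from the SHARP-TIME lift.** [cite: LuscherWolff1990] -/
theorem spread_dressedLiftFamily {k : ℕ} {C β : ℝ} (hβ : 0 < β) {φ : GaugeConfig 3 L SU2 → ℝ} (hφ : IsPhys φ)
    {g : Fin k → (GaugeConfig 3 1 SU2 → ℝ)} (hg : ∀ i, IsPhys (g i))
    (hn : ∀ i, 0 < l2 (liftFamily β φ g i) (liftFamily β φ g i)) (h : Spread k C β (liftFamily β φ g)) :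
    Spread k C β (dressedLiftFamily β φ g) := by
  have := spread_iterate hβ (fun i => isPhys_liftVec β hφ (hg i)) hn (dressSteps L) h
  intro i
  simpa only [dressedLiftFamily_apply] using this i

/-! ## §5 The reshape seam: SHARP-TIME upper Dirichlet band ⇒ variational (o5) of the DRESSED family; two-halves reassembly -/

/-- The sharp-time content of the variational half, in the tree's Dirichlet currency (`LiftPos.dirichletBand_of_position`, upper band only):
`λ₀ n_i − d_i ≤ λ₀ n_i (1 − e^{−Cλ²/L} μ_{i+1}(B)/μ₀(B))` — an UPPER bound on the one-step Dirichlet energy (quadratic variation) of channel `i`;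
for `u = liftFamily β φ g` the left side is `½∬(Δ(g_i∘Π_t))² φK_βφ` by `LiftPos.dirichlet_identity` (statement (V_i) of the card). [cite: Luscher1983, §3] -/
def DirichletUpper (k : ℕ) (C : ℝ) (β : ℝ) (u : Fin k → (GaugeConfig 3 L SU2 → ℝ)) : Prop :=
  ∀ i : Fin k,
    levelValue su2Rep L β 0 * l2 (u i) (u i) - l2 (u i) (transferApply β (u i)) ≤
      levelValue su2Rep L β 0 * l2 (u i) (u i) *
        (1 - (Real.exp (C * luscherLambda β L ^ 2 / L))⁻¹ * levelValue su2Rep 1 (oneSiteCoupling β L) ((i : ℕ) + 1) /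
          levelValue su2Rep 1 (oneSiteCoupling β L) 0)

/-- Upper Dirichlet band ⇒ variational half of (o5) (the `hhi` half of `LiftPos.position_of_dirichletBand`; `μ₀(B) > 0`). [folklore] -/
theorem positionVariational_of_dirichletUpper {k : ℕ} {C β : ℝ} {u : Fin k → (GaugeConfig 3 L SU2 → ℝ)}
    (hμ0 : 0 < levelValue su2Rep 1 (oneSiteCoupling β L) 0) (h : DirichletUpper k C β u) : PositionVariational k C β u := by
  intro i
  have hE : 0 < Real.exp (C * luscherLambda β L ^ 2 / L) := Real.exp_pos _
  set E := Real.exp (C * luscherLambda β L ^ 2 / L)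
  set m0 := levelValue su2Rep 1 (oneSiteCoupling β L) 0
  set m1 := levelValue su2Rep 1 (oneSiteCoupling β L) ((i : ℕ) + 1)
  set l0 := levelValue su2Rep L β 0
  set n := l2 (u i) (u i)
  set d := l2 (u i) (transferApply β (u i))
  have hhi : l0 * n - d ≤ l0 * n * (1 - E⁻¹ * m1 / m0) := h i
  have h1 : l0 * n * (E⁻¹ * m1 / m0) ≤ d := by linarith
  have h2 : l0 * n * (E⁻¹ * m1 / m0) * (E * m0) = m1 * l0 * n := by field_simp
  calc m1 * l0 * n = l0 * n * (E⁻¹ * m1 / m0) * (E * m0) := h2.symm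
    _ ≤ d * (E * m0) := mul_le_mul_of_nonneg_right h1 (mul_pos hE hμ0).le
    _ = E * (d * m0) := by ring

/-- ★★★ **SHARP ⇒ DRESSED on the variational side**: an upper Dirichlet band for the SHARP lift `liftFamily β φ g` (a `t ∈ {0,1}` vacuum statement)
gives the variational half of (o5) for the DRESSED family of record `dressedLiftFamily β φ g`, any `dressSteps`. [cite: LuscherWolff1990] -/
theorem positionVariational_dressed_of_sharp_dirichletUpper {k : ℕ} {C β : ℝ} (hβ : 0 < β) {φ : GaugeConfig 3 L SU2 → ℝ} (hφ : IsPhys φ)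
    {g : Fin k → (GaugeConfig 3 1 SU2 → ℝ)} (hg : ∀ i, IsPhys (g i))
    (hn : ∀ i, 0 < l2 (liftFamily β φ g i) (liftFamily β φ g i)) (hμ0 : 0 < levelValue su2Rep 1 (oneSiteCoupling β L) 0)
    (h : DirichletUpper k C β (liftFamily β φ g)) : PositionVariational k C β (dressedLiftFamily β φ g) :=
  positionVariational_dressedLiftFamily hβ hφ hg hn (positionVariational_of_dirichletUpper hμ0 h)

/-- ★ **Two-halves reassembly of `DynamicCoreClauses` for the dressed family**: sharp upper Dirichlet band (variational half) + anti-variational half and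
(o6) couplings of the dressed family (the spectral ∕ Euclidean part) ⇒ (o5) ∧ (o6) for `dressedLiftFamily β φ g`. [cite: LuscherWolff1990] -/
theorem dynamicCoreClauses_dressed_of_halves {k : ℕ} {C β : ℝ} (hβ : 0 < β) {φ : GaugeConfig 3 L SU2 → ℝ} (hφ : IsPhys φ)
    {g : Fin k → (GaugeConfig 3 1 SU2 → ℝ)} (hg : ∀ i, IsPhys (g i))
    (hn : ∀ i, 0 < l2 (liftFamily β φ g i) (liftFamily β φ g i)) (hμ0 : 0 < levelValue su2Rep 1 (oneSiteCoupling β L) 0)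
    (hvar : DirichletUpper k C β (liftFamily β φ g))
    (hanti : PositionAntiVariational k C β (dressedLiftFamily β φ g))
    (hcoup : ∀ i l : Fin k, i ≠ l →
      |l2 (dressedLiftFamily β φ g i) (transferApply β (dressedLiftFamily β φ g l)) -
          (l2 (dressedLiftFamily β φ g i) (transferApply β (dressedLiftFamily β φ g i)) /
                l2 (dressedLiftFamily β φ g i) (dressedLiftFamily β φ g i) +
              l2 (dressedLiftFamily β φ g l) (transferApply β (dressedLiftFamily β φ g l)) /
                l2 (dressedLiftFamily β φ g l) (dressedLiftFamily β φ g l)) / 2 *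
            l2 (dressedLiftFamily β φ g i) (dressedLiftFamily β φ g l)|
        ≤ C * (luscherLambda β L ^ 2 / L) * levelValue su2Rep L β 0 *
            (Real.sqrt (l2 (dressedLiftFamily β φ g i) (dressedLiftFamily β φ g i)) *
              Real.sqrt (l2 (dressedLiftFamily β φ g l) (dressedLiftFamily β φ g l)))) :
    DynamicCoreClauses k C β (dressedLiftFamily β φ g) :=
  dynamicCoreClauses_of_position hanti (positionVariational_dressed_of_sharp_dirichletUpper hβ hφ hg hn hμ0 hvar) hcoup

/-! ## §6 WINDOW-LEVEL seam for the skeleton of record («polyakovlift» r5): `stub_universality = ∀ k, ChannelUniversalityAt k` is implied by a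
SHARP-TIME variational half `ChannelUniversalityVarAt k` (kick currency; the fine side is the UNDRESSED lift `liftFamily β φ g`) and a dressed
anti-variational half `ChannelUniversalityAntiVarAt k` (the first (A5) conjunct and (A6′) for `dressedLiftFamily β φ g`, verbatim) — kernel-checked
composition `channelUniversalityAt_of_halves`, constants `C_var + C_anti`, `min lam0`, `max L0`.  The lead may split the stub BY NAME. -/

/-- Pure real: the variational-half transfer along a monotone dressing in the (A5).2 currency — sharp `d^o n_s λ₀ ≤ E_V (d_s n^o μ₀)`, monotone
`d_s n_d ≤ d_d n_s` (`n_s > 0`), `E_V ≤ E`, `d_d, n^o, μ₀, n_d ≥ 0` ⇒ dressed `d^o n_d λ₀ ≤ E (d_d n^o μ₀)` (no sign needed on `d^o`, `λ₀`). [folklore] -/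
theorem a5var_transfer {dO nS nD dS dD l0 m0 nO EV E : ℝ} (hnS : 0 < nS) (hnD : 0 ≤ nD) (hnO : 0 ≤ nO) (hm0 : 0 ≤ m0) (hdD : 0 ≤ dD)
    (hEV : 0 ≤ EV) (hE : EV ≤ E) (hP : dS * nD ≤ dD * nS) (hS : dO * nS * l0 ≤ EV * (dS * nO * m0)) :
    dO * nD * l0 ≤ E * (dD * nO * m0) := by
  have h2 : dO * nS * l0 * nD ≤ EV * (dS * nO * m0) * nD := mul_le_mul_of_nonneg_right hS hnD
  have h3 : EV * nO * m0 * (dS * nD) ≤ EV * nO * m0 * (dD * nS) :=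
    mul_le_mul_of_nonneg_left hP (mul_nonneg (mul_nonneg hEV hnO) hm0)
  have h1 : (dO * nD * l0) * nS ≤ (EV * (dD * nO * m0)) * nS := by nlinarith [h2, h3]
  have h4 : dO * nD * l0 ≤ EV * (dD * nO * m0) := le_of_mul_le_mul_right h1 hnS
  exact h4.trans (mul_le_mul_of_nonneg_right hE (mul_nonneg (mul_nonneg hdD hnO) hm0))

/-- Pure real: constant bump on the anti-variational (A5).1 conjunct — `0 ≤ LHS ≤ E_A X`, `0 < E_A ≤ E` ⇒ `LHS ≤ E X`. [folklore] -/
theorem a5anti_bump {lhs EA E X : ℝ} (hLHS : 0 ≤ lhs) (hEA : 0 < EA) (hE : EA ≤ E) (h : lhs ≤ EA * X) : lhs ≤ E * X := by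
  have hX : 0 ≤ X := by
    by_contra hneg
    push Not at hneg
    have : EA * X < 0 := mul_neg_of_pos_of_neg hEA hneg
    linarith
  exact h.trans (mul_le_mul_of_nonneg_right hE hX)

/-- **(A-var) `ChannelUniversalityVarAt k` — the SHARP-TIME variational half of `ChannelUniversalityAt k`**: same quantifier frame; for every channel
`i`, the sharp lift `v_i = liftFamily β φ g i` has positive norm and its one-step ratio is not BELOW the dressed one-site shadow's:
`d^o_i · n^v_i · λ₀ ≤ e^{Cλ²/L} · (d^v_i · n^o_i · μ₀)` — «trial energies of the sharp flowed-Polyakov insertions are not too high», a `t ∈ {0,1}`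
vacuum statement (kick currency: `λ₀ n^v − d^v = ½∬(Δ(g_i∘Π_t))² φK_βφ` by `LiftPos.dirichlet_identity`). [cite: Luscher1983, §3] [cite: LuscherWolff1990] -/
def ChannelUniversalityVarAt (k : ℕ) : Prop :=
  ∃ C lam0 : ℝ, 0 ≤ C ∧ 0 < lam0 ∧ ∀ lam : ℝ, 0 < lam → lam ≤ lam0 → ∃ L0 : ℕ,
    ∀ (L : ℕ) [NeZero L], L0 ≤ L → ∀ β : ℝ, InFemtoWindow lam β L →
      ∀ φ : GaugeConfig 3 L SU2 → ℝ, IsRawVacuum β φ →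
        ∀ (ω : GaugeConfig 3 1 SU2 → ℝ) (g : Fin k → (GaugeConfig 3 1 SU2 → ℝ)), LiftBasis (liftCoupling β L) k ω g →
          ∀ e₀ : GaugeConfig 3 1 SU2 → ℝ, IsRawVacuum (L := 1) (oneSiteCoupling β L) e₀ →
            let v := liftFamily β φ g
            let w := shadowFamily (oneSiteCoupling β L) L e₀ g
            let l0 := levelValue su2Rep L β 0
            let m0 := levelValue su2Rep 1 (oneSiteCoupling β L) 0
            ∀ i : Fin k, 0 < l2 (v i) (v i) ∧
              l2 (w i) (transferApply (oneSiteCoupling β L) (w i)) * l2 (v i) (v i) * l0 ≤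
                Real.exp (C * luscherLambda β L ^ 2 / L) * (l2 (v i) (transferApply β (v i)) * l2 (w i) (w i) * m0)

/-- **(A-anti) `ChannelUniversalityAntiVarAt k` — the dressed anti-variational half of `ChannelUniversalityAt k`**: same frame; the FIRST (A5)
conjunct (`d^u_i · n^o_i · μ₀ ≤ e^{Cλ²/L} · (d^o_i · n^u_i · λ₀)`: dressed one-step ratios not ABOVE the shadow's — the location ∕ no-intruder
direction) and (A6′) verbatim, for the dressed family of record `u = dressedLiftFamily β φ g` (the spectral ∕ Euclidean-currency part). [cite: LuscherWolff1990] -/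
def ChannelUniversalityAntiVarAt (k : ℕ) : Prop :=
  ∃ C lam0 : ℝ, 0 ≤ C ∧ 0 < lam0 ∧ ∀ lam : ℝ, 0 < lam → lam ≤ lam0 → ∃ L0 : ℕ,
    ∀ (L : ℕ) [NeZero L], L0 ≤ L → ∀ β : ℝ, InFemtoWindow lam β L →
      ∀ φ : GaugeConfig 3 L SU2 → ℝ, IsRawVacuum β φ →
        ∀ (ω : GaugeConfig 3 1 SU2 → ℝ) (g : Fin k → (GaugeConfig 3 1 SU2 → ℝ)), LiftBasis (liftCoupling β L) k ω g →
          ∀ e₀ : GaugeConfig 3 1 SU2 → ℝ, IsRawVacuum (L := 1) (oneSiteCoupling β L) e₀ →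
            let u := dressedLiftFamily β φ g
            let w := shadowFamily (oneSiteCoupling β L) L e₀ g
            let l0 := levelValue su2Rep L β 0
            let m0 := levelValue su2Rep 1 (oneSiteCoupling β L) 0
            (∀ i : Fin k,
              l2 (u i) (transferApply β (u i)) * l2 (w i) (w i) * m0 ≤
                  Real.exp (C * luscherLambda β L ^ 2 / L) * (l2 (w i) (transferApply (oneSiteCoupling β L) (w i)) * l2 (u i) (u i) * l0)) ∧
            (∀ i l : Fin k, i ≠ l →
              |(l2 (u i) (transferApply β (u l)) -
                  (l2 (u i) (transferApply β (u i)) / l2 (u i) (u i) + l2 (u l) (transferApply β (u l)) / l2 (u l) (u l)) / 2 *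
                    l2 (u i) (u l)) * m0 * (Real.sqrt (l2 (w i) (w i)) * Real.sqrt (l2 (w l) (w l))) -
                (l2 (w i) (transferApply (oneSiteCoupling β L) (w l)) -
                  (l2 (w i) (transferApply (oneSiteCoupling β L) (w i)) / l2 (w i) (w i) +
                      l2 (w l) (transferApply (oneSiteCoupling β L) (w l)) / l2 (w l) (w l)) / 2 * l2 (w i) (w l)) * l0 *
                  (Real.sqrt (l2 (u i) (u i)) * Real.sqrt (l2 (u l) (u l)))|
                ≤ C * (luscherLambda β L ^ 2 / L) * l0 * m0 *
                  (Real.sqrt (l2 (u i) (u i)) * Real.sqrt (l2 (u l) (u l))) * (Real.sqrt (l2 (w i) (w i)) * Real.sqrt (l2 (w l) (w l))))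

/-- ★★★ **S-UNIV′ from its two halves**: `ChannelUniversalityVarAt k → ChannelUniversalityAntiVarAt k → ChannelUniversalityAt k`.  The variational
half is transported from the SHARP lift to the dressed family of record by the monotone dressing lemma `d_mul_n_le_iterate` (any `dressSteps`);
constants `C_var + C_anti`. [cite: LuscherWolff1990] -/
theorem channelUniversalityAt_of_halves {k : ℕ} (hV : ChannelUniversalityVarAt k) (hA : ChannelUniversalityAntiVarAt k) :
    ChannelUniversalityAt k := by
  obtain ⟨CV, lV, hCV, hlV, hVk⟩ := hV
  obtain ⟨CA, lA, hCA, hlA, hAk⟩ := hA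
  refine ⟨CV + CA, min lV lA, by positivity, lt_min hlV hlA, fun lam hlam hle => ?_⟩
  obtain ⟨LV, hLV⟩ := hVk lam hlam (hle.trans (min_le_left _ _))
  obtain ⟨LA, hLA⟩ := hAk lam hlam (hle.trans (min_le_right _ _))
  refine ⟨max LV LA, fun L _ hL β hW φ hφ ω g hbasis e₀ he₀ => ?_⟩
  have hleV : LV ≤ L := (le_max_left _ _).trans hL
  have hleA : LA ≤ L := (le_max_right _ _).trans hL
  have hV' := hLV L hleV β hW φ hφ ω g hbasis e₀ he₀
  have hA' := hLA L hleA β hW φ hφ ω g hbasis e₀ he₀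
  dsimp only at hV' hA' ⊢
  obtain ⟨hA5, hA6⟩ := hA'
  -- positivity bookkeeping
  have hβpos : 0 < β := zero_lt_one.trans_le hW.1
  have hβ0 : 0 ≤ β := hβpos.le
  have hΛpos : 0 < luscherLambda β L := luscherLambda_pos_of_window hlam hW
  have hLpos : (0 : ℝ) < L := Nat.cast_pos.mpr (NeZero.pos L)
  have hBpos : 0 < oneSiteCoupling β L := by
    unfold oneSiteCoupling; exact div_pos (mul_pos two_pos (pow_pos hLpos 3)) (pow_pos hΛpos 3)
  have hm0pos : 0 < levelValue su2Rep 1 (oneSiteCoupling β L) 0 := levelValue_su2Rep_pos (L := 1) hBpos 0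
  have hl0nn : 0 ≤ levelValue su2Rep L β 0 := levelValue_su2Rep_nonneg L hβ0 0
  have hx : 0 ≤ luscherLambda β L ^ 2 / L := div_nonneg (sq_nonneg _) hLpos.le
  have hexpV : Real.exp (CV * luscherLambda β L ^ 2 / L) ≤ Real.exp ((CV + CA) * luscherLambda β L ^ 2 / L) := by
    apply Real.exp_le_exp.mpr
    have : CV * luscherLambda β L ^ 2 / L = CV * (luscherLambda β L ^ 2 / L) := by ring
    have : (CV + CA) * luscherLambda β L ^ 2 / L = (CV + CA) * (luscherLambda β L ^ 2 / L) := by ring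
    nlinarith [mul_nonneg hCA hx]
  have hexpA : Real.exp (CA * luscherLambda β L ^ 2 / L) ≤ Real.exp ((CV + CA) * luscherLambda β L ^ 2 / L) := by
    apply Real.exp_le_exp.mpr
    have : CA * luscherLambda β L ^ 2 / L = CA * (luscherLambda β L ^ 2 / L) := by ring
    have : (CV + CA) * luscherLambda β L ^ 2 / L = (CV + CA) * (luscherLambda β L ^ 2 / L) := by ring
    nlinarith [mul_nonneg hCV hx]
  have hg : ∀ i, IsPhys (g i) := hbasis.2.2.2.2.1
  have huP : ∀ i, IsPhys (dressedLiftFamily β φ g i) := fun i => isPhys_dressedLiftVec β hφ.1 (hg i)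
  have hdD : ∀ i, 0 ≤ l2 (dressedLiftFamily β φ g i) (transferApply β (dressedLiftFamily β φ g i)) := fun i => by
    rw [← qform_eq_l2_transferApply]; exact qform_su2Rep_self_nonneg hβ0 (huP i)
  refine ⟨fun i => ⟨?_, ?_⟩, fun i l hil => ?_⟩
  · -- (A5).1: anti-variational half, constant bumped
    exact a5anti_bump (mul_nonneg (mul_nonneg (hdD i) (l2_self_nonneg _)) hm0pos.le) (Real.exp_pos _) hexpA (hA5 i)
  · -- (A5).2: variational half, transported from the sharp lift by monotone dressing
    have hmono := d_mul_n_le_iterate hβpos (isPhys_liftVec β hφ.1 (hg i)) (hV' i).1 (dressSteps L)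
    rw [← dressedLiftFamily_apply] at hmono
    exact a5var_transfer (hV' i).1 (l2_self_nonneg _) (l2_self_nonneg _) hm0pos.le (hdD i) (Real.exp_pos _).le hexpV hmono (hV' i).2
  · -- (A6′): constant bumped
    refine (hA6 i l hil).trans ?_
    have hP : 0 ≤ (luscherLambda β L ^ 2 / L) * levelValue su2Rep L β 0 * levelValue su2Rep 1 (oneSiteCoupling β L) 0 *
        (Real.sqrt (l2 (dressedLiftFamily β φ g i) (dressedLiftFamily β φ g i)) *
          Real.sqrt (l2 (dressedLiftFamily β φ g l) (dressedLiftFamily β φ g l))) *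
        (Real.sqrt (l2 (shadowFamily (oneSiteCoupling β L) L e₀ g i) (shadowFamily (oneSiteCoupling β L) L e₀ g i)) *
          Real.sqrt (l2 (shadowFamily (oneSiteCoupling β L) L e₀ g l) (shadowFamily (oneSiteCoupling β L) L e₀ g l))) := by
      positivity
    nlinarith [mul_nonneg hCV hP]

/-- ★ The r3 text of S-POS from the two halves and the one-site shadow: `(∀k A-var) → (∀k A-anti) → (∀k B∃) → LiftPositionR3`, by NAME through
`liftPositionR3_of_channelUniversality_pscalingExists` («polyakovlift» r5). [cite: Luscher1983, §3] -/
theorem liftPositionR3_of_halves_pscalingExists (hV : ∀ k, ChannelUniversalityVarAt k) (hA : ∀ k, ChannelUniversalityAntiVarAt k)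
    (hB : ∀ k, PScalingExistsAt k) : LiftPositionR3 :=
  liftPositionR3_of_channelUniversality_pscalingExists (fun k => channelUniversalityAt_of_halves (hV k) (hA k)) hB

/-! ## §7 (rev 3) The DEFECT SANDWICH: a dressing step raises the Rayleigh quotient by the normalised leakage defect, within the factor `2λ₀/R`

For physical `w` write `n = ‖w‖²`, `a' = ⟨w,K_βw⟩`, `b' = ‖K_βw‖²`, `c' = ⟨K_βw, K_βK_βw⟩`, `R(w) = a'/n` and `δ(w) = 1 − a'²/(n·b')` — the NORMALISED
one-step leakage defect (`= sin²∠(w, K_βw)`; `n·b'·δ(w) = ‖K_βw‖²‖w‖² − ⟨w,K_βw⟩²` is the (o4)-defect, `δ ≥ 0` is the log-convexity floor (G3-d),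
`δ = 0` iff `w` is an eigenvector).  Testing the TOP OF THE SPECTRUM on the physical vector `z = K_βw − R(w)•w` gives
`c'n − a'b' ≤ 2λ₀(b'n − a'²)` (`sandwich_upper`), and `⟨z,K_βz⟩ ≥ 0` gives `a'(b'n − a'²) ≤ n(c'n − a'b')` (`sandwich_lower`); in ratio form
`R(w)·δ(w) ≤ R(K_βw) − R(w) ≤ 2λ₀·δ(w)`: ONE DRESSING STEP RAISES THE RAYLEIGH QUOTIENT BY EXACTLY THE NORMALISED DEFECT, up to the factor
`2λ₀/R(w) ≈ 2`.  Telescoped along the registered dressing (`defectSum β v m = Σ_{s<m} δ(K_β^s v)`, the INTEGRATED LEAKAGE PROFILE):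
`R(v)·(1 + defectSum) ≤ R(K_β^m v) ≤ R(v) + 2λ₀·defectSum`. -/

/-- Top of the spectrum, null vectors included: `⟨ψ,K_βψ⟩ ≤ λ₀‖ψ‖²` for every physical `ψ`. [cite: ReedSimonIV1978, Thm. XIII.1] -/
theorem qform_self_le_top (β : ℝ) {ψ : GaugeConfig 3 L SU2 → ℝ} (hψ : IsPhys ψ) :
    qform su2Rep β ψ ψ ≤ levelValue su2Rep L β 0 * l2 ψ ψ := by
  rcases (l2_self_nonneg ψ).eq_or_lt with h0 | hpos
  · have hK : IsPhys (transferApply (L := L) β ψ) := isPhys_transferApply β hψ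
    have h1 : l2 ψ (transferApply β ψ) ^ 2 ≤ l2 ψ ψ * l2 (transferApply β ψ) (transferApply β ψ) := sq_l2_le hψ hK
    rw [← h0, zero_mul] at h1
    have h2 : l2 ψ (transferApply β ψ) = 0 := (pow_eq_zero_iff two_ne_zero).mp (le_antisymm h1 (sq_nonneg _))
    rw [qform_eq_l2_transferApply, h2, ← h0, mul_zero]
  · exact qform_le_levelValue_zero_mul su2Rep continuous_su2Rep β hψ hpos

/-- The test pencil `K_βw − t•w` (written `K_βw + (−t)•w`) is physical. [folklore] -/
theorem isPhys_pencil (β t : ℝ) {w : GaugeConfig 3 L SU2 → ℝ} (hw : IsPhys w) :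
    IsPhys (transferApply (L := L) β w + (-t) • w) :=
  (isPhys_transferApply β hw).add (hw.smul (-t))

/-- `‖K_βw − t•w‖² = ‖K_βw‖² − 2t⟨w,K_βw⟩ + t²‖w‖²`. [folklore] -/
theorem l2_pencil (β t : ℝ) {w : GaugeConfig 3 L SU2 → ℝ} (hw : IsPhys w) :
    l2 (transferApply (L := L) β w + (-t) • w) (transferApply β w + (-t) • w) =
      l2 (transferApply β w) (transferApply β w) - 2 * t * qform su2Rep β w w + t ^ 2 * l2 w w := by
  have hK : IsPhys (transferApply (L := L) β w) := isPhys_transferApply β hw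
  have htw : IsPhys ((-t) • w) := hw.smul (-t)
  have hz : IsPhys (transferApply (L := L) β w + (-t) • w) := hK.add htw
  rw [l2_add_left hK htw hz, l2_smul_left (-t) w (transferApply β w + (-t) • w),
    l2_comm (transferApply β w) (transferApply β w + (-t) • w), l2_comm w (transferApply β w + (-t) • w),
    l2_add_left hK htw hK, l2_add_left hK htw hw, l2_smul_left (-t) w (transferApply β w), l2_smul_left (-t) w w,
    l2_transferApply_left β w w, ← qform_eq_l2_transferApply β w w]
  ring

/-- `⟨K_βw − t•w, K_β(K_βw − t•w)⟩ = ⟨K_βw,K_βK_βw⟩ − 2t‖K_βw‖² + t²⟨w,K_βw⟩`. [folklore] -/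
theorem qform_pencil {β : ℝ} (t : ℝ) {w : GaugeConfig 3 L SU2 → ℝ} (hw : IsPhys w) :
    qform su2Rep β (transferApply (L := L) β w + (-t) • w) (transferApply β w + (-t) • w) =
      qform su2Rep β (transferApply β w) (transferApply β w) - 2 * t * l2 (transferApply β w) (transferApply β w) +
        t ^ 2 * qform su2Rep β w w := by
  have hK : IsPhys (transferApply (L := L) β w) := isPhys_transferApply β hw
  have htw : IsPhys ((-t) • w) := hw.smul (-t)
  have hz : IsPhys (transferApply (L := L) β w + (-t) • w) := hK.add htw
  rw [qform_add_left β hK htw hz, qform_smul_left β (-t) w (transferApply β w + (-t) • w),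
    qform_su2Rep_comm β hK hz, qform_su2Rep_comm β hw hz, qform_add_left β hK htw hK, qform_add_left β hK htw hw,
    qform_smul_left β (-t) w (transferApply β w), qform_smul_left β (-t) w w, qform_su2Rep_comm β hw hK,
    qform_eq_l2_transferApply β (transferApply β w) w]
  ring

/-- ★★ **DEFECT SANDWICH — upper half (product form; every `β`, every physical `w`, null included):**
`⟨K_βw,K_βK_βw⟩·‖w‖² − ⟨w,K_βw⟩·‖K_βw‖² ≤ 2λ₀·(‖K_βw‖²‖w‖² − ⟨w,K_βw⟩²)`.
Proof: top of the spectrum on `z = K_βw − (a'/n)•w`, `a'/n ≤ λ₀`, Cauchy–Schwarz. [cite: ReedSimonIV1978, Thm. XIII.1] -/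
theorem sandwich_upper (β : ℝ) {w : GaugeConfig 3 L SU2 → ℝ} (hw : IsPhys w) :
    qform su2Rep β (transferApply β w) (transferApply β w) * l2 w w -
        qform su2Rep β w w * l2 (transferApply β w) (transferApply β w) ≤
      2 * levelValue su2Rep L β 0 * (l2 (transferApply β w) (transferApply β w) * l2 w w - qform su2Rep β w w ^ 2) := by
  have hK : IsPhys (transferApply (L := L) β w) := isPhys_transferApply β hw
  have hCS' : l2 w (transferApply β w) ^ 2 ≤ l2 w w * l2 (transferApply β w) (transferApply β w) := sq_l2_le hw hK
  rw [← qform_eq_l2_transferApply] at hCS'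
  have hpencil : ∀ t : ℝ, qform su2Rep β (transferApply β w) (transferApply β w) - 2 * t * l2 (transferApply β w) (transferApply β w) +
      t ^ 2 * qform su2Rep β w w ≤ levelValue su2Rep L β 0 * (l2 (transferApply β w) (transferApply β w) - 2 * t * qform su2Rep β w w +
        t ^ 2 * l2 w w) := fun t => by
    have h := qform_self_le_top (L := L) β (isPhys_pencil β t hw)
    rwa [qform_pencil t hw, l2_pencil β t hw] at h
  have hb2 : l2 w (transferApply β (transferApply β w)) ^ 2 ≤
      l2 w w * l2 (transferApply β (transferApply β w)) (transferApply β (transferApply β w)) := sq_l2_le hw (isPhys_transferApply β hK)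
  have hbw : l2 (transferApply β w) (transferApply β w) = l2 w (transferApply β (transferApply β w)) := l2_transferApply_comm β hw hK
  have htop : qform su2Rep β w w ≤ levelValue su2Rep L β 0 * l2 w w := qform_self_le_top β hw
  set n := l2 w w with hn_def
  set a' := qform su2Rep β w w with ha'_def
  set b' := l2 (transferApply (L := L) β w) (transferApply β w) with hb'_def
  set c' := qform su2Rep β (transferApply (L := L) β w) (transferApply β w) with hc'_def
  set l0 := levelValue su2Rep L β 0 with hl0_def
  have hn0 : 0 ≤ n := l2_self_nonneg w
  rcases hn0.eq_or_lt with h0 | hnpos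
  · -- null `w`: `a' = 0` and `b' = 0`
    have ha : a' = 0 := by
      have : a' ^ 2 ≤ 0 := by simpa [← h0] using hCS'
      exact (pow_eq_zero_iff two_ne_zero).mp (le_antisymm this (sq_nonneg _))
    have hb : b' = 0 := by
      rw [← h0, zero_mul] at hb2
      have h2 : l2 w (transferApply β (transferApply β w)) = 0 := (pow_eq_zero_iff two_ne_zero).mp (le_antisymm hb2 (sq_nonneg _))
      rw [hbw, h2]
    rw [← h0, ha, hb]; norm_num
  · set a := a' / n with ha_def
    have han : a * n = a' := div_mul_cancel₀ a' hnpos.ne'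
    have ha_le : a ≤ l0 := by rw [ha_def, div_le_iff₀ hnpos]; exact htop
    have hD : 0 ≤ b' - a * a' := by
      have e : b' - a * a' = (n * b' - a' ^ 2) / n := by rw [ha_def]; field_simp
      rw [e]; exact div_nonneg (by linarith) hnpos.le
    have hq := hpencil a
    have h3 : l0 * (a ^ 2 * n) = l0 * (a * a') := by linear_combination (l0 * a) * han
    have key : c' - a * b' ≤ 2 * l0 * (b' - a * a') := by nlinarith [hq, h3, mul_le_mul_of_nonneg_right ha_le hD]
    have e1 : c' * n - a' * b' = n * (c' - a * b') := by linear_combination b' * han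
    have e2 : 2 * l0 * (b' * n - a' ^ 2) = n * (2 * l0 * (b' - a * a')) := by linear_combination (2 * l0 * a') * han
    rw [e1, e2]
    exact mul_le_mul_of_nonneg_left key hnpos.le

/-- ★★ **DEFECT SANDWICH — lower half (product form):** `⟨w,K_βw⟩·(‖K_βw‖²‖w‖² − ⟨w,K_βw⟩²) ≤ ‖w‖²·(⟨K_βw,K_βK_βw⟩‖w‖² − ⟨w,K_βw⟩‖K_βw‖²)`
(from `⟨z,K_βz⟩ ≥ 0` on the same `z`; `β ≥ 0`). [cite: Luscher1977, §3] -/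
theorem sandwich_lower {β : ℝ} (hβ : 0 ≤ β) {w : GaugeConfig 3 L SU2 → ℝ} (hw : IsPhys w) :
    qform su2Rep β w w * (l2 (transferApply β w) (transferApply β w) * l2 w w - qform su2Rep β w w ^ 2) ≤
      l2 w w * (qform su2Rep β (transferApply β w) (transferApply β w) * l2 w w -
        qform su2Rep β w w * l2 (transferApply β w) (transferApply β w)) := by
  have hK : IsPhys (transferApply (L := L) β w) := isPhys_transferApply β hw
  have hCS' : l2 w (transferApply β w) ^ 2 ≤ l2 w w * l2 (transferApply β w) (transferApply β w) := sq_l2_le hw hK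
  rw [← qform_eq_l2_transferApply] at hCS'
  have hpos_pencil : ∀ t : ℝ, 0 ≤ qform su2Rep β (transferApply β w) (transferApply β w) -
      2 * t * l2 (transferApply β w) (transferApply β w) + t ^ 2 * qform su2Rep β w w := fun t => by
    have h := qform_su2Rep_self_nonneg hβ (isPhys_pencil (L := L) β t hw)
    rwa [qform_pencil t hw] at h
  set n := l2 w w with hn_def
  set a' := qform su2Rep β w w with ha'_def
  set b' := l2 (transferApply (L := L) β w) (transferApply β w) with hb'_def
  set c' := qform su2Rep β (transferApply (L := L) β w) (transferApply β w) with hc'_def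
  have hn0 : 0 ≤ n := l2_self_nonneg w
  rcases hn0.eq_or_lt with h0 | hnpos
  · have ha : a' = 0 := by
      have : a' ^ 2 ≤ 0 := by simpa [← h0] using hCS'
      exact (pow_eq_zero_iff two_ne_zero).mp (le_antisymm this (sq_nonneg _))
    rw [← h0, ha]; norm_num
  · set a := a' / n with ha_def
    have han : a * n = a' := div_mul_cancel₀ a' hnpos.ne'
    have hz0 := hpos_pencil a
    have key : a * (b' - a * a') ≤ c' - a * b' := by nlinarith [hz0]
    have e1 : a' * (b' * n - a' ^ 2) = n ^ 2 * (a * (b' - a * a')) := by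
      linear_combination (a' * (n * a + a') - b' * n) * han
    have e2 : n * (c' * n - a' * b') = n ^ 2 * (c' - a * b') := by linear_combination (n * b') * han
    rw [e1, e2]
    exact mul_le_mul_of_nonneg_left key (sq_nonneg _)

/-- The Rayleigh quotient `R_β(u) = ⟨u,K_βu⟩/‖u‖²` (`= 0` on null `u`). [folklore] -/
def rayleigh (β : ℝ) (u : GaugeConfig 3 L SU2 → ℝ) : ℝ := qform su2Rep β u u / l2 u u

/-- The NORMALISED one-step leakage defect `δ_β(u) = 1 − ⟨u,K_βu⟩²/(‖u‖²‖K_βu‖²) = sin²∠(u, K_βu)` (`n·b'·δ` is the (o4)-defect of the clause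
`PolyakovLift.LeakageClause` at the Rayleigh quotient). [cite: LuscherWolff1990, §2] -/
def defect (β : ℝ) (u : GaugeConfig 3 L SU2 → ℝ) : ℝ :=
  1 - qform su2Rep β u u ^ 2 / (l2 u u * l2 (transferApply β u) (transferApply β u))

/-- `0 ≤ δ_β(u)` (Cauchy–Schwarz = the log-convexity floor (G3-d)). [folklore] -/
theorem defect_nonneg (β : ℝ) {u : GaugeConfig 3 L SU2 → ℝ} (hu : IsPhys u) : 0 ≤ defect β u := by
  unfold defect
  have hCS : qform su2Rep β u u ^ 2 ≤ l2 u u * l2 (transferApply β u) (transferApply β u) := by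
    rw [qform_eq_l2_transferApply]; exact sq_l2_le hu (isPhys_transferApply β hu)
  have := div_le_one_of_le₀ hCS (mul_nonneg (l2_self_nonneg _) (l2_self_nonneg _))
  linarith

/-- `δ_β(u) ≤ 1`. [folklore] -/
theorem defect_le_one (β : ℝ) (u : GaugeConfig 3 L SU2 → ℝ) : defect β u ≤ 1 := by
  unfold defect
  have := div_nonneg (sq_nonneg (qform su2Rep β u u)) (mul_nonneg (l2_self_nonneg u) (l2_self_nonneg (transferApply (L := L) β u)))
  linarith

/-- ★★ **Sandwich, ratio form (upper):** `R(K_βw) − R(w) ≤ 2λ₀·δ(w)` (`β > 0`, `‖w‖² > 0`). [cite: ReedSimonIV1978, Thm. XIII.1] -/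
theorem rayleigh_step_le {β : ℝ} (hβ : 0 < β) {w : GaugeConfig 3 L SU2 → ℝ} (hw : IsPhys w) (hn : 0 < l2 w w) :
    rayleigh β (transferApply β w) - rayleigh β w ≤ 2 * levelValue su2Rep L β 0 * defect β w := by
  have hb : 0 < l2 (transferApply (L := L) β w) (transferApply β w) := by
    simpa only [Function.iterate_one] using l2_iterate_self_pos hβ hw hn 1
  have h := sandwich_upper β hw
  unfold rayleigh defect
  rw [div_sub_div _ _ hb.ne' hn.ne', one_sub_div (mul_pos hn hb).ne', ← mul_div_assoc, div_le_div_iff₀ (mul_pos hb hn) (mul_pos hn hb)]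
  nlinarith [mul_le_mul_of_nonneg_right h (mul_pos hn hb).le]

/-- ★★ **Sandwich, ratio form (lower):** `R(w)·δ(w) ≤ R(K_βw) − R(w)`. [cite: Luscher1977, §3] -/
theorem rayleigh_step_ge {β : ℝ} (hβ : 0 < β) {w : GaugeConfig 3 L SU2 → ℝ} (hw : IsPhys w) (hn : 0 < l2 w w) :
    rayleigh β w * defect β w ≤ rayleigh β (transferApply β w) - rayleigh β w := by
  have hb : 0 < l2 (transferApply (L := L) β w) (transferApply β w) := by
    simpa only [Function.iterate_one] using l2_iterate_self_pos hβ hw hn 1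
  have h := sandwich_lower hβ.le hw
  unfold rayleigh defect
  rw [div_sub_div _ _ hb.ne' hn.ne', one_sub_div (mul_pos hn hb).ne', div_mul_div_comm,
    div_le_div_iff₀ (mul_pos hn (mul_pos hn hb)) (mul_pos hb hn)]
  nlinarith [mul_le_mul_of_nonneg_right (mul_le_mul_of_nonneg_right h hb.le) hn.le]

/-- The integrated leakage profile `defectSum β v m = Σ_{s<m} δ_β(K_β^s v)` along the dressing `v ↦ K_β^m v`. [cite: LuscherWolff1990, §2] -/
def defectSum (β : ℝ) (v : GaugeConfig 3 L SU2 → ℝ) (m : ℕ) : ℝ :=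
  ∑ s ∈ Finset.range m, defect β ((transferApply (L := L) β)^[s] v)

theorem defectSum_zero (β : ℝ) (v : GaugeConfig 3 L SU2 → ℝ) : defectSum β v 0 = 0 := by simp [defectSum]

theorem defectSum_succ (β : ℝ) (v : GaugeConfig 3 L SU2 → ℝ) (m : ℕ) :
    defectSum β v (m + 1) = defectSum β v m + defect β ((transferApply (L := L) β)^[m] v) := by
  simp [defectSum, Finset.sum_range_succ]

/-- `0 ≤ defectSum ≤ m`. [folklore] -/
theorem defectSum_nonneg (β : ℝ) {v : GaugeConfig 3 L SU2 → ℝ} (hv : IsPhys v) (m : ℕ) : 0 ≤ defectSum β v m :=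
  Finset.sum_nonneg fun s _ => defect_nonneg β (isPhys_iterate_transferApply β hv s)

/-- ★★★ **Telescoped sandwich (upper):** `R(K_β^m v) ≤ R(v) + 2λ₀·defectSum β v m` — the TOTAL rise of the Rayleigh quotient under the dressing is at
most `2λ₀ ×` the integrated leakage profile. [cite: ReedSimonIV1978, Thm. XIII.1] [cite: LuscherWolff1990, §2] -/
theorem rayleigh_iterate_le_add_defectSum {β : ℝ} (hβ : 0 < β) {v : GaugeConfig 3 L SU2 → ℝ} (hv : IsPhys v) (hn : 0 < l2 v v) (m : ℕ) :
    rayleigh β ((transferApply (L := L) β)^[m] v) ≤ rayleigh β v + 2 * levelValue su2Rep L β 0 * defectSum β v m := by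
  induction m with
  | zero => simp [defectSum_zero]
  | succ m ih =>
    have hw : IsPhys ((transferApply (L := L) β)^[m] v) := isPhys_iterate_transferApply β hv m
    have hwn := l2_iterate_self_pos hβ hv hn m
    have hstep := rayleigh_step_le hβ hw hwn
    rw [Function.iterate_succ_apply', defectSum_succ]
    linarith

/-- ★★★ **Telescoped sandwich (lower):** `R(v)·(1 + defectSum β v m) ≤ R(K_β^m v)` — the rise is AT LEAST `R(v) ×` the profile: up to the factor
`2λ₀/R(v)` the two telescopes coincide, so «dressed Rayleigh quotient − sharp Rayleigh quotient ≍ integrated leakage profile». [cite: Luscher1977, §3] -/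
theorem rayleigh_mul_one_add_defectSum_le {β : ℝ} (hβ : 0 < β) {v : GaugeConfig 3 L SU2 → ℝ} (hv : IsPhys v) (hn : 0 < l2 v v) (m : ℕ) :
    rayleigh β v * (1 + defectSum β v m) ≤ rayleigh β ((transferApply (L := L) β)^[m] v) := by
  induction m with
  | zero => simp [defectSum_zero]
  | succ m ih =>
    have hw : IsPhys ((transferApply (L := L) β)^[m] v) := isPhys_iterate_transferApply β hv m
    have hwn := l2_iterate_self_pos hβ hv hn m
    have hstep := rayleigh_step_ge hβ hw hwn
    have hmono : rayleigh β v ≤ rayleigh β ((transferApply (L := L) β)^[m] v) := rayleigh_le_rayleigh_iterate hβ hv hn m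
    have hδ : 0 ≤ defect β ((transferApply (L := L) β)^[m] v) := defect_nonneg β hw
    rw [Function.iterate_succ_apply', defectSum_succ]
    nlinarith [ih, hstep, mul_le_mul_of_nonneg_right hmono hδ]

/-! ## §8 (rev 3) Seams: the dressed anti-variational half ⟸ the SHARP two-sided kick statistic + a small leakage profile — and conversely

CONSEQUENCE of §7 for the line of record.  The anti-variational half of (o5) ∕ the first (A5) conjunct («dressed energies not too low» — the one
half §1–§6 could NOT move to sharp time) holds for `u_i = K_β^{dressSteps L} v_i` as soon as (i) it holds for the SHARP lift `v_i` (a `t ∈ {0,1}`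
vacuum statement, NECESSARY anyway since `R(v_i) ≤ R(u_i)`) and (ii) the integrated leakage profile is small, `Σ_{s<L} δ(K_β^s v_i) ≤ C·λ²/L`
(up to the order-one normalisation `μ_{i+1}/μ₀`, resp. the shadow ratio); constants add (`C_A + 2C_D`).  Conversely (`one_add_defectSum_le_of_twoSided`)
the two-sided (A5) for the dressed family together with the sharp variational half FORCES `defectSum ≤ e^{(C_A+C_V)λ²/L} − 1`: the split is lossless.
So NO eigenvector ∕ level information beyond the top of the spectrum is needed to pass from sharp to dressed: what the renormalisation group must
supply is the two-sided SHARP kick statistic (precision `o(λ/L)` relative — the Lüscher numbers) and an UPPER BOUND of the right order on the profile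
(power-counting grade: `δ_s` is expected `O(λ⁴/(L(s+1)³))` from semi-hard pairs plus `O(λ²Δε²λ²/L²)` from tower neighbours, two powers of `λ` inside
the tolerance; §9 bounds it by SHARP-TIME spectral weights alone). -/

/-- `e^{a} + b ≤ e^{a+b}` for `a, b ≥ 0`. [folklore] -/
theorem exp_add_le_exp_add {a b : ℝ} (ha : 0 ≤ a) (hb : 0 ≤ b) : Real.exp a + b ≤ Real.exp (a + b) := by
  rw [Real.exp_add]
  nlinarith [Real.add_one_le_exp b, Real.one_le_exp ha, Real.exp_pos a,
    mul_le_mul_of_nonneg_left (Real.add_one_le_exp b) (Real.exp_pos a).le]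

omit [NeZero L] in
/-- `0 ≤ oneSiteCoupling β L`. [folklore] -/
theorem oneSiteCoupling_nonneg (β : ℝ) : 0 ≤ oneSiteCoupling β L := by
  have hlam : 0 ≤ luscherLambda β L := by
    unfold luscherLambda; exact Real.rpow_nonneg (le_max_right _ _) _
  unfold oneSiteCoupling; positivity

omit [NeZero L] in
/-- `0 ≤ μ_j(B)` at `B = oneSiteCoupling β L`. [folklore] -/
theorem levelValue_oneSiteCoupling_nonneg (β : ℝ) (j : ℕ) : 0 ≤ levelValue su2Rep 1 (oneSiteCoupling β L) j :=
  levelValue_su2Rep_nonneg 1 (oneSiteCoupling_nonneg (L := L) β) j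

/-- `R_β(u)·‖u‖² = ⟨u, K_βu⟩` for `‖u‖² > 0` (clause currency `d = l2 u (K u)`). [folklore] -/
theorem rayleigh_mul_l2 (β : ℝ) {u : GaugeConfig 3 L SU2 → ℝ} (hn : 0 < l2 u u) :
    rayleigh β u * l2 u u = l2 u (transferApply β u) := by
  unfold rayleigh; rw [qform_eq_l2_transferApply, div_mul_cancel₀ _ hn.ne']

/-- **`DefectSumSmall k C β v`** — the integrated leakage profile of every channel vector along the registered dressing is `O(λ²/L)` in the units of
(o5): `μ₀(B)·Σ_{s<dressSteps L} δ_β(K_β^s v_i) ≤ C·(λ²/L)·μ_{i+1}(B)`, `B = oneSiteCoupling β L` (`μ_{i+1}/μ₀ ∈ (0,1]`, `→ 1` in the window).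
A pure UPPER BOUND; power-counting grade (see §8's docstring). [cite: LuscherWolff1990, §2] -/
def DefectSumSmall (k : ℕ) (C : ℝ) (β : ℝ) (v : Fin k → (GaugeConfig 3 L SU2 → ℝ)) : Prop :=
  ∀ i : Fin k, levelValue su2Rep 1 (oneSiteCoupling β L) 0 * defectSum β (v i) (dressSteps L) ≤
    C * (luscherLambda β L ^ 2 / L) * levelValue su2Rep 1 (oneSiteCoupling β L) ((i : ℕ) + 1)

/-- ★★★ **SHARP + PROFILE ⇒ DRESSED on the anti-variational side (μ-currency).**  If the anti-variational half of (o5) holds for the SHARP lift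
`liftFamily β φ g` with constant `C_A` and the leakage profile is small with constant `C_D`, then the anti-variational half holds for the dressed family
of record `dressedLiftFamily β φ g` with constant `C_A + 2C_D`. [cite: ReedSimonIV1978, Thm. XIII.1] [cite: LuscherWolff1990, §2] -/
theorem positionAntiVariational_dressed_of_sharp_defectSum {k : ℕ} {CA CD β : ℝ} (hβ : 0 < β) (hCA : 0 ≤ CA) (hCD : 0 ≤ CD)
    {φ : GaugeConfig 3 L SU2 → ℝ} (hφ : IsPhys φ) {g : Fin k → (GaugeConfig 3 1 SU2 → ℝ)} (hg : ∀ i, IsPhys (g i))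
    (hn : ∀ i, 0 < l2 (liftFamily β φ g i) (liftFamily β φ g i))
    (hA : PositionAntiVariational k CA β (liftFamily β φ g)) (hD : DefectSumSmall k CD β (liftFamily β φ g)) :
    PositionAntiVariational k (CA + 2 * CD) β (dressedLiftFamily β φ g) := by
  intro i
  have hvP : IsPhys (liftFamily β φ g i) := isPhys_liftVec β hφ (hg i)
  rw [dressedLiftFamily_apply]
  set v : GaugeConfig 3 L SU2 → ℝ := liftFamily β φ g i with hv_def
  set m := dressSteps L with hm_def
  set u : GaugeConfig 3 L SU2 → ℝ := (transferApply (L := L) β)^[m] v with hu_def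
  set l0 := levelValue su2Rep L β 0 with hl0
  set m0 := levelValue su2Rep 1 (oneSiteCoupling β L) 0 with hm0
  set m1 := levelValue su2Rep 1 (oneSiteCoupling β L) ((i : ℕ) + 1) with hm1
  have hl0nn : 0 ≤ l0 := levelValue_su2Rep_nonneg L hβ.le 0
  have hm0nn : 0 ≤ m0 := levelValue_oneSiteCoupling_nonneg (L := L) β 0
  have hm1nn : 0 ≤ m1 := levelValue_oneSiteCoupling_nonneg (L := L) β ((i : ℕ) + 1)
  have hLpos : (0 : ℝ) < L := Nat.cast_pos.mpr (NeZero.pos L)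
  have hx : 0 ≤ luscherLambda β L ^ 2 / L := div_nonneg (sq_nonneg _) hLpos.le
  have hvn : 0 < l2 v v := hn i
  have hun : 0 < l2 u u := l2_iterate_self_pos hβ hvP hvn m
  have htel := rayleigh_iterate_le_add_defectSum hβ hvP hvn m
  have hAv : l2 v (transferApply β v) * m0 ≤ Real.exp (CA * luscherLambda β L ^ 2 / L) * (m1 * l0) * l2 v v := hA i
  have hDv : m0 * defectSum β v m ≤ CD * (luscherLambda β L ^ 2 / L) * m1 := hD i
  have hRv : rayleigh β v * m0 ≤ Real.exp (CA * luscherLambda β L ^ 2 / L) * (m1 * l0) := by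
    have h1 : rayleigh β v * m0 * l2 v v ≤ Real.exp (CA * luscherLambda β L ^ 2 / L) * (m1 * l0) * l2 v v := by
      calc rayleigh β v * m0 * l2 v v = rayleigh β v * l2 v v * m0 := by ring
        _ = l2 v (transferApply β v) * m0 := by rw [rayleigh_mul_l2 β hvn]
        _ ≤ _ := hAv
    exact le_of_mul_le_mul_right h1 hvn
  have hexp : Real.exp (CA * luscherLambda β L ^ 2 / L) + 2 * (CD * (luscherLambda β L ^ 2 / L)) ≤
      Real.exp ((CA + 2 * CD) * luscherLambda β L ^ 2 / L) := by
    have e : (CA + 2 * CD) * luscherLambda β L ^ 2 / L = CA * luscherLambda β L ^ 2 / L + 2 * (CD * (luscherLambda β L ^ 2 / L)) := by ring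
    rw [e]
    refine exp_add_le_exp_add ?_ (by positivity)
    have : CA * luscherLambda β L ^ 2 / L = CA * (luscherLambda β L ^ 2 / L) := by ring
    rw [this]; exact mul_nonneg hCA hx
  have hRu : rayleigh β u * m0 ≤ Real.exp ((CA + 2 * CD) * luscherLambda β L ^ 2 / L) * (m1 * l0) := by
    calc rayleigh β u * m0 ≤ (rayleigh β v + 2 * l0 * defectSum β v m) * m0 := mul_le_mul_of_nonneg_right htel hm0nn
      _ = rayleigh β v * m0 + 2 * l0 * (m0 * defectSum β v m) := by ring
      _ ≤ Real.exp (CA * luscherLambda β L ^ 2 / L) * (m1 * l0) + 2 * l0 * (CD * (luscherLambda β L ^ 2 / L) * m1) :=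
          add_le_add hRv (mul_le_mul_of_nonneg_left hDv (by positivity))
      _ = (Real.exp (CA * luscherLambda β L ^ 2 / L) + 2 * (CD * (luscherLambda β L ^ 2 / L))) * (m1 * l0) := by ring
      _ ≤ Real.exp ((CA + 2 * CD) * luscherLambda β L ^ 2 / L) * (m1 * l0) := mul_le_mul_of_nonneg_right hexp (mul_nonneg hm1nn hl0nn)
  calc l2 u (transferApply β u) * m0 = rayleigh β u * m0 * l2 u u := by rw [← rayleigh_mul_l2 β hun]; ring
    _ ≤ Real.exp ((CA + 2 * CD) * luscherLambda β L ^ 2 / L) * (m1 * l0) * l2 u u := mul_le_mul_of_nonneg_right hRu hun.le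

/-- ★ Two-halves reassembly in μ-currency, rev 3: sharp upper Dirichlet band (variational half, §5) + SHARP anti-variational half + profile bound
+ the (o6) couplings of the dressed family ⇒ `DynamicCoreClauses k (C_A + 2C_D) β (dressedLiftFamily β φ g)` (take `C_V ≤ C_A + 2C_D`). [cite: LuscherWolff1990, §2] -/
theorem dynamicCoreClauses_dressed_of_sharp {k : ℕ} {CA CD β : ℝ} (hβ : 0 < β) (hCA : 0 ≤ CA) (hCD : 0 ≤ CD)
    {φ : GaugeConfig 3 L SU2 → ℝ} (hφ : IsPhys φ) {g : Fin k → (GaugeConfig 3 1 SU2 → ℝ)} (hg : ∀ i, IsPhys (g i))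
    (hn : ∀ i, 0 < l2 (liftFamily β φ g i) (liftFamily β φ g i)) (hμ0 : 0 < levelValue su2Rep 1 (oneSiteCoupling β L) 0)
    (hvar : DirichletUpper k (CA + 2 * CD) β (liftFamily β φ g))
    (hanti : PositionAntiVariational k CA β (liftFamily β φ g)) (hD : DefectSumSmall k CD β (liftFamily β φ g))
    (hcoup : ∀ i l : Fin k, i ≠ l →
      |l2 (dressedLiftFamily β φ g i) (transferApply β (dressedLiftFamily β φ g l)) -
          (l2 (dressedLiftFamily β φ g i) (transferApply β (dressedLiftFamily β φ g i)) /
                l2 (dressedLiftFamily β φ g i) (dressedLiftFamily β φ g i) +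
              l2 (dressedLiftFamily β φ g l) (transferApply β (dressedLiftFamily β φ g l)) /
                l2 (dressedLiftFamily β φ g l) (dressedLiftFamily β φ g l)) / 2 *
            l2 (dressedLiftFamily β φ g i) (dressedLiftFamily β φ g l)|
        ≤ (CA + 2 * CD) * (luscherLambda β L ^ 2 / L) * levelValue su2Rep L β 0 *
            (Real.sqrt (l2 (dressedLiftFamily β φ g i) (dressedLiftFamily β φ g i)) *
              Real.sqrt (l2 (dressedLiftFamily β φ g l) (dressedLiftFamily β φ g l)))) :
    DynamicCoreClauses k (CA + 2 * CD) β (dressedLiftFamily β φ g) :=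
  dynamicCoreClauses_of_position (positionAntiVariational_dressed_of_sharp_defectSum hβ hCA hCD hφ hg hn hanti hD)
    (positionVariational_dressed_of_sharp_dirichletUpper hβ hφ hg hn hμ0 hvar) hcoup

/-- Pure real: the anti-variational (A5).1 transfer SHARP ⇒ DRESSED along the telescoped sandwich.  `R_u ≤ R_v + 2l₀S` (§7), sharp
`d^v n^w m₀ ≤ E_A(d^w n^v l₀)`, profile `S·(n^w m₀) ≤ B·d^w`, `E_A + 2B ≤ E` ⇒ dressed `d^u n^w m₀ ≤ E(d^w n^u l₀)`. [folklore] -/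
theorem a5anti_of_sharp_defectSum {dV nV dU nU dW nW m0 l0 S EA B E : ℝ} (hnV : 0 < nV) (hnU : 0 < nU) (hnW : 0 ≤ nW) (hm0 : 0 ≤ m0)
    (hdV : 0 ≤ dV) (hl0 : 0 < l0) (hEA : 0 < EA)
    (htel : dU / nU ≤ dV / nV + 2 * l0 * S) (hsharp : dV * nW * m0 ≤ EA * (dW * nV * l0)) (hdef : S * (nW * m0) ≤ B * dW)
    (hE : EA + 2 * B ≤ E) : dU * nW * m0 ≤ E * (dW * nU * l0) := by
  have hdW : 0 ≤ dW := by
    by_contra hneg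
    push Not at hneg
    have h1 : EA * (dW * nV * l0) < 0 := mul_neg_of_pos_of_neg hEA (mul_neg_of_neg_of_pos (mul_neg_of_neg_of_pos hneg hnV) hl0)
    have h2 : 0 ≤ dV * nW * m0 := mul_nonneg (mul_nonneg hdV hnW) hm0
    linarith
  have hRv : dV / nV * (nW * m0) ≤ EA * (dW * l0) := by
    have e : dV / nV * (nW * m0) * nV = dV * nW * m0 := by
      rw [div_mul_eq_mul_div, div_mul_cancel₀ _ hnV.ne']; ring
    have h1 : dV / nV * (nW * m0) * nV ≤ EA * (dW * l0) * nV := by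
      rw [e]
      calc dV * nW * m0 ≤ EA * (dW * nV * l0) := hsharp
        _ = EA * (dW * l0) * nV := by ring
    exact le_of_mul_le_mul_right h1 hnV
  have hRu : dU / nU * (nW * m0) ≤ E * (dW * l0) := by
    calc dU / nU * (nW * m0) ≤ (dV / nV + 2 * l0 * S) * (nW * m0) := mul_le_mul_of_nonneg_right htel (mul_nonneg hnW hm0)
      _ = dV / nV * (nW * m0) + 2 * l0 * (S * (nW * m0)) := by ring
      _ ≤ EA * (dW * l0) + 2 * l0 * (B * dW) := add_le_add hRv (mul_le_mul_of_nonneg_left hdef (by positivity))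
      _ = (EA + 2 * B) * (dW * l0) := by ring
      _ ≤ E * (dW * l0) := mul_le_mul_of_nonneg_right hE (mul_nonneg hdW hl0.le)
  have e : dU / nU * (nW * m0) * nU = dU * nW * m0 := by
    rw [div_mul_eq_mul_div, div_mul_cancel₀ _ hnU.ne']; ring
  rw [← e]
  calc dU / nU * (nW * m0) * nU ≤ E * (dW * l0) * nU := mul_le_mul_of_nonneg_right hRu hnU.le
    _ = E * (dW * nU * l0) := by ring

/-- ★ Pure real: **the split is LOSSLESS.**  Two-sided (A5) for the dressed family (`R_u (n^w m₀) ≤ E_A d^w l₀`) + the sharp variational half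
(`d^w l₀ ≤ E_V R_v (n^w m₀)`) + the lower telescope `R_v(1 + S) ≤ R_u` (§7) force `1 + S ≤ E_A·E_V`, i.e. `defectSum ≤ e^{(C_A+C_V)λ²/L} − 1`
(`R_v > 0`, `n^w m₀ > 0`). [folklore] -/
theorem one_add_defectSum_le_of_twoSided {RV RU S N dWl0 EA EV : ℝ} (hRV : 0 < RV) (hN : 0 < N) (hEA : 0 ≤ EA)
    (hlow : RV * (1 + S) ≤ RU) (hanti : RU * N ≤ EA * dWl0) (hvar : dWl0 ≤ EV * (RV * N)) : 1 + S ≤ EA * EV := by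
  have h : RV * N * (1 + S) ≤ RV * N * (EA * EV) := by
    calc RV * N * (1 + S) = RV * (1 + S) * N := by ring
      _ ≤ RU * N := mul_le_mul_of_nonneg_right hlow hN.le
      _ ≤ EA * dWl0 := hanti
      _ ≤ EA * (EV * (RV * N)) := mul_le_mul_of_nonneg_left hvar hEA
      _ = RV * N * (EA * EV) := by ring
  exact le_of_mul_le_mul_left h (mul_pos hRV hN)

/-- **(A-sharp) `ChannelUniversalitySharpAt k`** — the TWO-SIDED SHARP kick statistic: the quantifier frame of `ChannelUniversalityAt k`; for every
channel `i` the SHARP lift `v_i = liftFamily β φ g i` has positive norm and BOTH (A5) inequalities hold between `v_i` and the dressed one-site shadow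
`w_i`: `d^v n^w μ₀ ≤ e^{Cλ²/L}(d^w n^v λ₀)` and `d^w n^v λ₀ ≤ e^{Cλ²/L}(d^v n^w μ₀)` — a `t ∈ {0,1}` vacuum statement on both sides
(kick ∕ Dirichlet currency by `LiftPos.dirichlet_identity`: `λ₀n^v − d^v = ½∬(Δ(g_i∘Π_t))²φK_βφ`).  This is where ALL the one-loop precision of
S-UNIV′ lives. [cite: Luscher1983, §3] [cite: LuscherWolff1990, §2] -/
def ChannelUniversalitySharpAt (k : ℕ) : Prop :=
  ∃ C lam0 : ℝ, 0 ≤ C ∧ 0 < lam0 ∧ ∀ lam : ℝ, 0 < lam → lam ≤ lam0 → ∃ L0 : ℕ,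
    ∀ (L : ℕ) [NeZero L], L0 ≤ L → ∀ β : ℝ, InFemtoWindow lam β L →
      ∀ φ : GaugeConfig 3 L SU2 → ℝ, IsRawVacuum β φ →
        ∀ (ω : GaugeConfig 3 1 SU2 → ℝ) (g : Fin k → (GaugeConfig 3 1 SU2 → ℝ)), LiftBasis (liftCoupling β L) k ω g →
          ∀ e₀ : GaugeConfig 3 1 SU2 → ℝ, IsRawVacuum (L := 1) (oneSiteCoupling β L) e₀ →
            let v := liftFamily β φ g
            let w := shadowFamily (oneSiteCoupling β L) L e₀ g
            let l0 := levelValue su2Rep L β 0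
            let m0 := levelValue su2Rep 1 (oneSiteCoupling β L) 0
            ∀ i : Fin k, 0 < l2 (v i) (v i) ∧
              l2 (v i) (transferApply β (v i)) * l2 (w i) (w i) * m0 ≤
                  Real.exp (C * luscherLambda β L ^ 2 / L) * (l2 (w i) (transferApply (oneSiteCoupling β L) (w i)) * l2 (v i) (v i) * l0) ∧
              l2 (w i) (transferApply (oneSiteCoupling β L) (w i)) * l2 (v i) (v i) * l0 ≤
                  Real.exp (C * luscherLambda β L ^ 2 / L) * (l2 (v i) (transferApply β (v i)) * l2 (w i) (w i) * m0)

/-- **(A-profile) `DefectSumAt k`** — the integrated leakage profile of every sharp channel vector along the registered dressing is `O(λ²/L)` in units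
of the shadow's one-step ratio `r^w_i = d^w_i/(n^w_i μ₀) ∈ [0,1]` (`→ μ_{i+1}/μ₀ → 1`):
`(Σ_{s<dressSteps L} δ_β(K_β^s v_i))·(n^w_i μ₀) ≤ C(λ²/L)·d^w_i`.  Upper bound of power-counting grade. [cite: LuscherWolff1990, §2] -/
def DefectSumAt (k : ℕ) : Prop :=
  ∃ C lam0 : ℝ, 0 ≤ C ∧ 0 < lam0 ∧ ∀ lam : ℝ, 0 < lam → lam ≤ lam0 → ∃ L0 : ℕ,
    ∀ (L : ℕ) [NeZero L], L0 ≤ L → ∀ β : ℝ, InFemtoWindow lam β L →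
      ∀ φ : GaugeConfig 3 L SU2 → ℝ, IsRawVacuum β φ →
        ∀ (ω : GaugeConfig 3 1 SU2 → ℝ) (g : Fin k → (GaugeConfig 3 1 SU2 → ℝ)), LiftBasis (liftCoupling β L) k ω g →
          ∀ e₀ : GaugeConfig 3 1 SU2 → ℝ, IsRawVacuum (L := 1) (oneSiteCoupling β L) e₀ →
            let v := liftFamily β φ g
            let w := shadowFamily (oneSiteCoupling β L) L e₀ g
            let m0 := levelValue su2Rep 1 (oneSiteCoupling β L) 0
            ∀ i : Fin k, defectSum β (v i) (dressSteps L) * (l2 (w i) (w i) * m0) ≤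
              C * (luscherLambda β L ^ 2 / L) * l2 (w i) (transferApply (oneSiteCoupling β L) (w i))

/-- **(A6′) `CouplingUniversalityAt k`** — the coupling conjunct of `ChannelUniversalityAt k` for the dressed family, verbatim (the second conjunct of
`ChannelUniversalityAntiVarAt k`). [cite: LuscherWolff1990, §2] -/
def CouplingUniversalityAt (k : ℕ) : Prop :=
  ∃ C lam0 : ℝ, 0 ≤ C ∧ 0 < lam0 ∧ ∀ lam : ℝ, 0 < lam → lam ≤ lam0 → ∃ L0 : ℕ,
    ∀ (L : ℕ) [NeZero L], L0 ≤ L → ∀ β : ℝ, InFemtoWindow lam β L →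
      ∀ φ : GaugeConfig 3 L SU2 → ℝ, IsRawVacuum β φ →
        ∀ (ω : GaugeConfig 3 1 SU2 → ℝ) (g : Fin k → (GaugeConfig 3 1 SU2 → ℝ)), LiftBasis (liftCoupling β L) k ω g →
          ∀ e₀ : GaugeConfig 3 1 SU2 → ℝ, IsRawVacuum (L := 1) (oneSiteCoupling β L) e₀ →
            let u := dressedLiftFamily β φ g
            let w := shadowFamily (oneSiteCoupling β L) L e₀ g
            let l0 := levelValue su2Rep L β 0
            let m0 := levelValue su2Rep 1 (oneSiteCoupling β L) 0
            ∀ i l : Fin k, i ≠ l →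
              |(l2 (u i) (transferApply β (u l)) -
                  (l2 (u i) (transferApply β (u i)) / l2 (u i) (u i) + l2 (u l) (transferApply β (u l)) / l2 (u l) (u l)) / 2 *
                    l2 (u i) (u l)) * m0 * (Real.sqrt (l2 (w i) (w i)) * Real.sqrt (l2 (w l) (w l))) -
                (l2 (w i) (transferApply (oneSiteCoupling β L) (w l)) -
                  (l2 (w i) (transferApply (oneSiteCoupling β L) (w i)) / l2 (w i) (w i) +
                      l2 (w l) (transferApply (oneSiteCoupling β L) (w l)) / l2 (w l) (w l)) / 2 * l2 (w i) (w l)) * l0 *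
                  (Real.sqrt (l2 (u i) (u i)) * Real.sqrt (l2 (u l) (u l)))|
                ≤ C * (luscherLambda β L ^ 2 / L) * l0 * m0 *
                  (Real.sqrt (l2 (u i) (u i)) * Real.sqrt (l2 (u l) (u l))) * (Real.sqrt (l2 (w i) (w i)) * Real.sqrt (l2 (w l) (w l)))

/-- The sharp two-sided statistic contains §6's sharp variational half. [folklore] -/
theorem channelUniversalityVarAt_of_sharp {k : ℕ} (hS : ChannelUniversalitySharpAt k) : ChannelUniversalityVarAt k := by
  obtain ⟨C, lam0, hC, hlam0, h⟩ := hS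
  refine ⟨C, lam0, hC, hlam0, fun lam hlam hle => ?_⟩
  obtain ⟨L0, hL0⟩ := h lam hlam hle
  refine ⟨L0, fun L _ hL β hW φ hφ ω g hbasis e₀ he₀ i => ?_⟩
  have h' := hL0 L hL β hW φ hφ ω g hbasis e₀ he₀ i
  exact ⟨h'.1, h'.2.2⟩

/-- ★★★ **SHARP + PROFILE + (A6′) ⇒ the dressed anti-variational half `ChannelUniversalityAntiVarAt k`** (constant `C_S + 2C_D + C_6`): the first (A5)
conjunct for `dressedLiftFamily β φ g` follows from the sharp two-sided statistic and the profile bound through the telescoped sandwich of §7 — no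
eigenvector or level information. [cite: ReedSimonIV1978, Thm. XIII.1] [cite: LuscherWolff1990, §2] -/
theorem channelUniversalityAntiVarAt_of_sharp_defectSum {k : ℕ} (hS : ChannelUniversalitySharpAt k) (hD : DefectSumAt k)
    (h6 : CouplingUniversalityAt k) : ChannelUniversalityAntiVarAt k := by
  obtain ⟨CS, lS, hCS, hlS, hSk⟩ := hS
  obtain ⟨CD, lD, hCD, hlD, hDk⟩ := hD
  obtain ⟨C6, l6, hC6, hl6, h6k⟩ := h6
  refine ⟨CS + 2 * CD + C6, min (min lS lD) l6, by positivity, lt_min (lt_min hlS hlD) hl6, fun lam hlam hle => ?_⟩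
  obtain ⟨LS, hLS⟩ := hSk lam hlam (hle.trans ((min_le_left _ _).trans (min_le_left _ _)))
  obtain ⟨LD, hLD⟩ := hDk lam hlam (hle.trans ((min_le_left _ _).trans (min_le_right _ _)))
  obtain ⟨L6, hL6⟩ := h6k lam hlam (hle.trans (min_le_right _ _))
  refine ⟨max (max LS LD) L6, fun L _ hL β hW φ hφ ω g hbasis e₀ he₀ => ?_⟩
  have hS' := hLS L (((le_max_left _ _).trans (le_max_left _ _)).trans hL) β hW φ hφ ω g hbasis e₀ he₀
  have hD' := hLD L (((le_max_right _ _).trans (le_max_left _ _)).trans hL) β hW φ hφ ω g hbasis e₀ he₀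
  have h6' := hL6 L ((le_max_right _ _).trans hL) β hW φ hφ ω g hbasis e₀ he₀
  dsimp only at hS' hD' h6' ⊢
  -- positivity bookkeeping
  have hβpos : 0 < β := zero_lt_one.trans_le hW.1
  have hΛpos : 0 < luscherLambda β L := luscherLambda_pos_of_window hlam hW
  have hLpos : (0 : ℝ) < L := Nat.cast_pos.mpr (NeZero.pos L)
  have hBpos : 0 < oneSiteCoupling β L := by
    unfold oneSiteCoupling; exact div_pos (mul_pos two_pos (pow_pos hLpos 3)) (pow_pos hΛpos 3)
  have hm0pos : 0 < levelValue su2Rep 1 (oneSiteCoupling β L) 0 := levelValue_su2Rep_pos (L := 1) hBpos 0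
  have hl0nn : 0 ≤ levelValue su2Rep L β 0 := levelValue_su2Rep_nonneg L hβpos.le 0
  have hx : 0 ≤ luscherLambda β L ^ 2 / L := div_nonneg (sq_nonneg _) hLpos.le
  have hg : ∀ i, IsPhys (g i) := hbasis.2.2.2.2.1
  have hexpA : Real.exp (CS * luscherLambda β L ^ 2 / L) + 2 * (CD * (luscherLambda β L ^ 2 / L)) ≤
      Real.exp ((CS + 2 * CD + C6) * luscherLambda β L ^ 2 / L) := by
    have e : CS * luscherLambda β L ^ 2 / L + 2 * (CD * (luscherLambda β L ^ 2 / L)) = (CS + 2 * CD) * (luscherLambda β L ^ 2 / L) := by ring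
    have e' : (CS + 2 * CD + C6) * luscherLambda β L ^ 2 / L = (CS + 2 * CD) * (luscherLambda β L ^ 2 / L) + C6 * (luscherLambda β L ^ 2 / L) := by
      ring
    calc Real.exp (CS * luscherLambda β L ^ 2 / L) + 2 * (CD * (luscherLambda β L ^ 2 / L))
        ≤ Real.exp (CS * luscherLambda β L ^ 2 / L + 2 * (CD * (luscherLambda β L ^ 2 / L))) :=
          exp_add_le_exp_add (by rw [show CS * luscherLambda β L ^ 2 / L = CS * (luscherLambda β L ^ 2 / L) by ring]; exact mul_nonneg hCS hx)
            (by positivity)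
      _ ≤ Real.exp ((CS + 2 * CD + C6) * luscherLambda β L ^ 2 / L) := by
          rw [e, e']; exact Real.exp_le_exp.mpr (le_add_of_nonneg_right (mul_nonneg hC6 hx))
  refine ⟨fun i => ?_, fun i l hil => ?_⟩
  · -- (A5).1 for the dressed family from the sharp two-sided statistic + the profile
    obtain ⟨hnv, hanti, -⟩ := hS' i
    have hvP : IsPhys (liftFamily β φ g i) := isPhys_liftVec β hφ.1 (hg i)
    have hun : 0 < l2 (dressedLiftFamily β φ g i) (dressedLiftFamily β φ g i) := by
      rw [dressedLiftFamily_apply]; exact l2_iterate_self_pos hβpos hvP hnv (dressSteps L)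
    have htel : l2 (dressedLiftFamily β φ g i) (transferApply β (dressedLiftFamily β φ g i)) /
          l2 (dressedLiftFamily β φ g i) (dressedLiftFamily β φ g i) ≤
        l2 (liftFamily β φ g i) (transferApply β (liftFamily β φ g i)) / l2 (liftFamily β φ g i) (liftFamily β φ g i) +
          2 * levelValue su2Rep L β 0 * defectSum β (liftFamily β φ g i) (dressSteps L) := by
      have h := rayleigh_iterate_le_add_defectSum hβpos hvP hnv (dressSteps L)
      unfold rayleigh at h
      simpa only [qform_eq_l2_transferApply, dressedLiftFamily_apply] using h
    have hdV : 0 ≤ l2 (liftFamily β φ g i) (transferApply β (liftFamily β φ g i)) := by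
      rw [← qform_eq_l2_transferApply]; exact qform_su2Rep_self_nonneg hβpos.le hvP
    exact a5anti_of_sharp_defectSum hnv hun (l2_self_nonneg _) hm0pos.le hdV (levelValue_su2Rep_pos hβpos 0) (Real.exp_pos _)
      htel hanti (hD' i) hexpA
  · -- (A6′): constant bumped
    refine (h6' i l hil).trans ?_
    have hP : 0 ≤ (luscherLambda β L ^ 2 / L) * levelValue su2Rep L β 0 * levelValue su2Rep 1 (oneSiteCoupling β L) 0 *
        (Real.sqrt (l2 (dressedLiftFamily β φ g i) (dressedLiftFamily β φ g i)) *
          Real.sqrt (l2 (dressedLiftFamily β φ g l) (dressedLiftFamily β φ g l))) *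
        (Real.sqrt (l2 (shadowFamily (oneSiteCoupling β L) L e₀ g i) (shadowFamily (oneSiteCoupling β L) L e₀ g i)) *
          Real.sqrt (l2 (shadowFamily (oneSiteCoupling β L) L e₀ g l) (shadowFamily (oneSiteCoupling β L) L e₀ g l))) := by
      positivity
    nlinarith [mul_nonneg (add_nonneg hCS (mul_nonneg zero_le_two hCD)) hP]

/-- ★★★ **S-UNIV′ from SHARP + PROFILE + (A6′)**: `ChannelUniversalitySharpAt k → DefectSumAt k → CouplingUniversalityAt k → ChannelUniversalityAt k`
(by NAME the body of the registered `stub_universality` of «polyakovlift» r5, via §6's `channelUniversalityAt_of_halves`).  The (A5) clause of the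
dressed family of record is thereby reduced to `t ∈ {0,1}` vacuum statistics of the sharp flowed-Polyakov insertions (two-sided, precision-carrying)
plus an upper bound on the integrated leakage profile (power-counting grade). [cite: Luscher1983, §3] [cite: LuscherWolff1990, §2] -/
theorem channelUniversalityAt_of_sharp_defectSum_coupling {k : ℕ} (hS : ChannelUniversalitySharpAt k) (hD : DefectSumAt k)
    (h6 : CouplingUniversalityAt k) : ChannelUniversalityAt k :=
  channelUniversalityAt_of_halves (channelUniversalityVarAt_of_sharp hS) (channelUniversalityAntiVarAt_of_sharp_defectSum hS hD h6)

/-- The r3 text of S-POS from SHARP + PROFILE + (A6′) + the one-site shadow (B∃), by NAME through r5's composition. [cite: Luscher1983, §3] -/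
theorem liftPositionR3_of_sharp_defectSum_coupling_pscalingExists (hS : ∀ k, ChannelUniversalitySharpAt k) (hD : ∀ k, DefectSumAt k)
    (h6 : ∀ k, CouplingUniversalityAt k) (hB : ∀ k, PScalingExistsAt k) : LiftPositionR3 :=
  liftPositionR3_of_channelUniversality_pscalingExists (fun k => channelUniversalityAt_of_sharp_defectSum_coupling (hS k) (hD k) (h6 k)) hB


/-! ## §9 (rev 3) The leakage profile is controlled by SHARP-TIME spectral weights (s1's kinematic lever cut XIV, summed over the depths)

Let `ψ_j` be an exact physical `l2`-orthonormal eigenfamily of `K_β` (levels `ev_j`) whose orthogonal complement is dominated by `Λ`, `j₀` the own index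
(`μ = ev_{j₀} > 0`, own sharp weight `w_{j₀} = ⟨x,ψ_{j₀}⟩² > 0`), `S` a «tower» index set with `ev_j ≤ μ` off `S` and `ev_j^{2s} ≤ A·μ^{2s}` on `S`
(`s < m`; `A = 1` if the whole tower lies below the own level, `A = e^{2a}` for neighbours above within `μ(1 + a/m)`), and `(s+1)²Λ^{2s} ≤ μ^{2s}` for
`s < m` (e.g. `Λ ≤ μ/e`, s1's `LiftLeak.gap_of_le_div_exp`; at fixed lattice such an eigenfamily always exists).  Then (`defectSum_le_of_sharp_weights`)
`defectSum β x m ≤ m·A·Σ_{j∈S}(ev_j − μ)²w_j/(μ²w_{j₀}) + 2·(‖x‖² − Σ_{j∈S}w_j)/w_{j₀}`: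
per depth `δ(K^s x) ≤ ‖(K_β − μ)K^s x‖²/‖K^{s+1}x‖²` (`defect_le_residual_div`) and s1's `LiftLeak.residual_iterate_le_kinematic` (support XIV) cuts every
lever BELOW the own level to `μ²/(s+1)²` — SUMMABLE in the depth (`Σ_{s}1/(s+1)² ≤ 2`, `sum_inv_succ_sq_le`): along the whole dressing the hard sector
costs twice its SHARP-TIME RELATIVE WEIGHT, not weight × lever² × depth.  In the stub's currency (`m = dressSteps L = L`; tower levers
`(ev_j − μ)² ≤ D²(Λλ₀/L)²`, tower weights `W_S ≤ C_t·w_{j₀}` — ANY `O(1)` (one loop: `O(λ²)`); hard weight `‖x‖² − Σ_S w_j ≤ C_h(Λ²/L)w_{j₀}` — true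
size `κλ⁴/L` at energies `O(1)` by cdisprove (G1-d′), two powers to spare): `defectSum ≤ (A·D²·C_t·(λ₀/μ)² + 2C_h)·Λ²/L`, i.e. `DefectSumSmall` ∕
`DefectSumAt` with a window-uniform constant.  All inputs are SHARP-TIME (`t = 0`) spectral weights of the undressed flowed-Polyakov insertion plus exact
spectral kinematics — the same currency as s1's (NEAR₁)∕(BAND)∕(OUT) cores for S-LEAK (XIX), with (OUT) needed at its true size `O(λ⁴/L)` rather than the
`L`-uniform `O(λ³)` placeholder. -/

/-- `Σ_{s<m} 1/(s+1)² ≤ 2 − 2/(m+1)` (`≤ 2`). [folklore] -/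
theorem sum_inv_succ_sq_le (m : ℕ) : ∑ s ∈ Finset.range m, 1 / ((s : ℝ) + 1) ^ 2 ≤ 2 - 2 / ((m : ℝ) + 1) := by
  induction m with
  | zero => norm_num
  | succ m ih =>
    rw [Finset.sum_range_succ, Nat.cast_succ]
    have hm : (0 : ℝ) < (m : ℝ) + 1 := by positivity
    have hm2 : (0 : ℝ) < (m : ℝ) + 1 + 1 := by positivity
    have key : 1 / ((m : ℝ) + 1) ^ 2 ≤ 2 / ((m : ℝ) + 1) - 2 / ((m : ℝ) + 1 + 1) := by
      rw [div_sub_div _ _ hm.ne' hm2.ne', div_le_div_iff₀ (by positivity) (by positivity)]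
      nlinarith
    linarith

/-- The normalised defect is dominated by ANY relative squared residual: `δ_β(w) ≤ ‖K_βw − a•w‖²/‖K_βw‖²` (`β > 0`, `‖w‖² > 0`; the Rayleigh quotient
minimises the residual — cf. s1's `LiftLeak.residual_at_rayleigh_le`). [cite: Kato1949, §1] -/
theorem defect_le_residual_div {β : ℝ} (hβ : 0 < β) {w : GaugeConfig 3 L SU2 → ℝ} (hw : IsPhys w) (hn : 0 < l2 w w) (a : ℝ) :
    defect β w ≤ l2 (transferApply β w - a • w) (transferApply β w - a • w) / l2 (transferApply β w) (transferApply β w) := by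
  have hb : 0 < l2 (transferApply (L := L) β w) (transferApply β w) := by
    simpa only [Function.iterate_one] using l2_iterate_self_pos hβ hw hn 1
  have hsub : transferApply (L := L) β w - a • w = transferApply β w + (-a) • w := by rw [sub_eq_add_neg, neg_smul]
  rw [hsub, l2_pencil β a hw]
  unfold defect
  rw [one_sub_div (mul_pos hn hb).ne', div_le_div_iff₀ (mul_pos hn hb) hb]
  nlinarith [mul_nonneg hb.le (sq_nonneg (qform su2Rep β w w - a * l2 w w))]

/-- ★★★ **The leakage profile from SHARP-TIME spectral weights.**  See the section docstring for the reading; hypotheses as in s1's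
`LiftLeak.residual_iterate_le_kinematic` at every depth `s < m`, plus `ev_j^{2s} ≤ A·μ^{2s}` on the tower set `S`.
[cite: ReedSimonIV1978, Thm. XIII.1] [cite: LuscherWolff1990, §2] [cite: Kato1949, §1] -/
theorem defectSum_le_of_sharp_weights {β : ℝ} (hβ : 0 < β) {N : ℕ} {ψ : Fin N → (GaugeConfig 3 L SU2 → ℝ)} (hψ : ∀ j, IsPhys (ψ j))
    (hon : ∀ i l, l2 (ψ i) (ψ l) = if i = l then 1 else 0) (ev : Fin N → ℝ)
    (heig : ∀ j, transferApply β (ψ j) = ev j • ψ j) {Λ : ℝ} (hΛ : 0 ≤ Λ)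
    (hdom : ∀ φ : GaugeConfig 3 L SU2 → ℝ, IsPhys φ → (∀ j, l2 φ (ψ j) = 0) → l2 φ (transferApply β φ) ≤ Λ * l2 φ φ)
    {x : GaugeConfig 3 L SU2 → ℝ} (hx : IsPhys x) (j₀ : Fin N) (hμ : 0 < ev j₀) (hw0 : 0 < l2 x (ψ j₀) ^ 2) (hΛμ : Λ ≤ ev j₀)
    (S : Finset (Fin N)) (hS : ∀ j, j ∉ S → ev j ≤ ev j₀) (m : ℕ)
    (hgap : ∀ s : ℕ, s < m → ((s : ℝ) + 1) ^ 2 * Λ ^ (2 * s) ≤ ev j₀ ^ (2 * s))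
    {A : ℝ} (hA : ∀ j ∈ S, ∀ s : ℕ, s < m → ev j ^ (2 * s) ≤ A * ev j₀ ^ (2 * s)) :
    defectSum β x m ≤
      (m : ℝ) * A * ((∑ j ∈ S, (ev j - ev j₀) ^ 2 * l2 x (ψ j) ^ 2) / (ev j₀ ^ 2 * l2 x (ψ j₀) ^ 2)) +
        2 * ((l2 x x - ∑ j ∈ S, l2 x (ψ j) ^ 2) / l2 x (ψ j₀) ^ 2) := by
  classical
  -- sharp-time positivity
  have hxn : 0 < l2 x x := by
    have h := LiftLeak.normSq_iterate_ge_level β hψ hon ev heig hx 0 j₀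
    simp only [mul_zero, pow_zero, one_mul, Function.iterate_zero, id_eq] at h
    exact lt_of_lt_of_le hw0 h
  have hY0 : 0 ≤ l2 x x - ∑ j ∈ S, l2 x (ψ j) ^ 2 := by
    have hnorm := LiftLeak.normSq_split_eigenfamily hψ hon hx
    have hsumw := (Finset.sum_add_sum_compl S (fun j => l2 x (ψ j) ^ 2)).symm
    have hc : 0 ≤ ∑ j ∈ Sᶜ, l2 x (ψ j) ^ 2 := Finset.sum_nonneg fun j _ => sq_nonneg _
    linarith [l2_self_nonneg (x - ∑ j, l2 x (ψ j) • ψ j)]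
  have hev0 : ∀ j, 0 ≤ ev j := LiftLeak.eigen_nonneg hβ.le hψ hon ev heig
  set μ := ev j₀ with hμdef
  set w0 := l2 x (ψ j₀) ^ 2 with hw0def
  set W := l2 x x - ∑ j ∈ S, l2 x (ψ j) ^ 2 with hWdef
  set T := ∑ j ∈ S, (ev j - μ) ^ 2 * l2 x (ψ j) ^ 2 with hTdef
  set X := T / (μ ^ 2 * w0) with hXdef
  set Y := W / w0 with hYdef
  have hYnn : 0 ≤ Y := div_nonneg hY0 hw0.le
  -- per-depth bound
  have hstep : ∀ s : ℕ, s < m → defect β ((transferApply (L := L) β)^[s] x) ≤ A * X + 1 / ((s : ℝ) + 1) ^ 2 * Y := by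
    intro s hs
    have hxsP : IsPhys ((transferApply (L := L) β)^[s] x) := isPhys_iterate_transferApply β hx s
    have hxsn : 0 < l2 ((transferApply (L := L) β)^[s] x) ((transferApply β)^[s] x) := l2_iterate_self_pos hβ hx hxn s
    have h1 := defect_le_residual_div hβ hxsP hxsn μ
    have hnum := LiftLeak.residual_iterate_le_kinematic hβ.le hψ hon ev heig hΛ hdom hx s j₀ hΛμ S hS (hgap s hs)
    have hden := LiftLeak.normSq_iterate_ge_level β hψ hon ev heig hx (s + 1) j₀
    rw [Function.iterate_succ_apply'] at hden
    have hdenpos : 0 < μ ^ (2 * (s + 1)) * w0 := mul_pos (pow_pos hμ _) hw0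
    have hKpos : 0 < l2 (transferApply β ((transferApply (L := L) β)^[s] x)) (transferApply β ((transferApply β)^[s] x)) :=
      lt_of_lt_of_le hdenpos hden
    -- the kinematic numerator, with the tower dressing factors bounded by `A`
    have hTs : ∑ j ∈ S, (ev j - μ) ^ 2 * ev j ^ (2 * s) * l2 x (ψ j) ^ 2 ≤ A * μ ^ (2 * s) * T := by
      rw [hTdef, Finset.mul_sum]
      refine Finset.sum_le_sum fun j hj => ?_
      have hAj := hA j hj s hs
      calc (ev j - μ) ^ 2 * ev j ^ (2 * s) * l2 x (ψ j) ^ 2 = (ev j - μ) ^ 2 * l2 x (ψ j) ^ 2 * ev j ^ (2 * s) := by ring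
        _ ≤ (ev j - μ) ^ 2 * l2 x (ψ j) ^ 2 * (A * μ ^ (2 * s)) :=
            mul_le_mul_of_nonneg_left hAj (mul_nonneg (sq_nonneg _) (sq_nonneg _))
        _ = A * μ ^ (2 * s) * ((ev j - μ) ^ 2 * l2 x (ψ j) ^ 2) := by ring
    have hNUMnn : 0 ≤ ∑ j ∈ S, (ev j - μ) ^ 2 * ev j ^ (2 * s) * l2 x (ψ j) ^ 2 + μ ^ (2 * s + 2) / ((s : ℝ) + 1) ^ 2 * W :=
      add_nonneg (Finset.sum_nonneg fun j _ => mul_nonneg (mul_nonneg (sq_nonneg _) (pow_nonneg (hev0 j) _)) (sq_nonneg _))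
        (mul_nonneg (div_nonneg (pow_nonneg hμ.le _) (sq_nonneg _)) hY0)
    have hNUM : ∑ j ∈ S, (ev j - μ) ^ 2 * ev j ^ (2 * s) * l2 x (ψ j) ^ 2 + μ ^ (2 * s + 2) / ((s : ℝ) + 1) ^ 2 * W ≤
        (A * X + 1 / ((s : ℝ) + 1) ^ 2 * Y) * (μ ^ (2 * (s + 1)) * w0) := by
      have hp : μ ^ (2 * (s + 1)) = μ ^ (2 * s) * μ ^ 2 := by
        rw [show 2 * (s + 1) = 2 * s + 2 by ring, pow_add]
      have hμ2w : μ ^ 2 * w0 ≠ 0 := (mul_pos (pow_pos hμ 2) hw0).ne'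
      have eX : A * X * (μ ^ (2 * s) * μ ^ 2 * w0) = A * μ ^ (2 * s) * T := by
        calc A * X * (μ ^ (2 * s) * μ ^ 2 * w0) = A * μ ^ (2 * s) * (T / (μ ^ 2 * w0) * (μ ^ 2 * w0)) := by rw [hXdef]; ring
          _ = A * μ ^ (2 * s) * T := by rw [div_mul_cancel₀ _ hμ2w]
      have eY : 1 / ((s : ℝ) + 1) ^ 2 * Y * (μ ^ (2 * s) * μ ^ 2 * w0) = μ ^ (2 * s + 2) / ((s : ℝ) + 1) ^ 2 * W := by
        have hWw : W / w0 * w0 = W := div_mul_cancel₀ _ hw0.ne'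
        calc 1 / ((s : ℝ) + 1) ^ 2 * Y * (μ ^ (2 * s) * μ ^ 2 * w0) = μ ^ (2 * s) * μ ^ 2 / ((s : ℝ) + 1) ^ 2 * (W / w0 * w0) := by
              rw [hYdef]; ring
          _ = μ ^ (2 * s + 2) / ((s : ℝ) + 1) ^ 2 * W := by rw [hWw, pow_add]
      calc ∑ j ∈ S, (ev j - μ) ^ 2 * ev j ^ (2 * s) * l2 x (ψ j) ^ 2 + μ ^ (2 * s + 2) / ((s : ℝ) + 1) ^ 2 * W
          ≤ A * μ ^ (2 * s) * T + μ ^ (2 * s + 2) / ((s : ℝ) + 1) ^ 2 * W := by linarith [hTs]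
        _ = (A * X + 1 / ((s : ℝ) + 1) ^ 2 * Y) * (μ ^ (2 * (s + 1)) * w0) := by rw [hp, add_mul, eX, eY]
    calc defect β ((transferApply (L := L) β)^[s] x)
        ≤ l2 (transferApply β ((transferApply β)^[s] x) - μ • (transferApply β)^[s] x)
              (transferApply β ((transferApply β)^[s] x) - μ • (transferApply β)^[s] x) /
            l2 (transferApply β ((transferApply (L := L) β)^[s] x)) (transferApply β ((transferApply β)^[s] x)) := h1
      _ ≤ (∑ j ∈ S, (ev j - μ) ^ 2 * ev j ^ (2 * s) * l2 x (ψ j) ^ 2 + μ ^ (2 * s + 2) / ((s : ℝ) + 1) ^ 2 * W) /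
            l2 (transferApply β ((transferApply (L := L) β)^[s] x)) (transferApply β ((transferApply β)^[s] x)) :=
          div_le_div_of_nonneg_right hnum hKpos.le
      _ ≤ (∑ j ∈ S, (ev j - μ) ^ 2 * ev j ^ (2 * s) * l2 x (ψ j) ^ 2 + μ ^ (2 * s + 2) / ((s : ℝ) + 1) ^ 2 * W) /
            (μ ^ (2 * (s + 1)) * w0) := div_le_div_of_nonneg_left hNUMnn hdenpos hden
      _ ≤ (A * X + 1 / ((s : ℝ) + 1) ^ 2 * Y) * (μ ^ (2 * (s + 1)) * w0) / (μ ^ (2 * (s + 1)) * w0) :=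
          div_le_div_of_nonneg_right hNUM hdenpos.le
      _ = A * X + 1 / ((s : ℝ) + 1) ^ 2 * Y := mul_div_cancel_right₀ _ hdenpos.ne'
  -- sum over the depths
  have hsum : ∑ s ∈ Finset.range m, (A * X + 1 / ((s : ℝ) + 1) ^ 2 * Y) =
      (m : ℝ) * (A * X) + (∑ s ∈ Finset.range m, 1 / ((s : ℝ) + 1) ^ 2) * Y := by
    rw [Finset.sum_add_distrib, Finset.sum_const, Finset.card_range, nsmul_eq_mul, Finset.sum_mul]
  have hT2 : ∑ s ∈ Finset.range m, 1 / ((s : ℝ) + 1) ^ 2 ≤ 2 := by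
    have h := sum_inv_succ_sq_le m
    have : 0 ≤ 2 / ((m : ℝ) + 1) := by positivity
    linarith
  calc defectSum β x m = ∑ s ∈ Finset.range m, defect β ((transferApply (L := L) β)^[s] x) := rfl
    _ ≤ ∑ s ∈ Finset.range m, (A * X + 1 / ((s : ℝ) + 1) ^ 2 * Y) :=
        Finset.sum_le_sum fun s hs => hstep s (Finset.mem_range.mp hs)
    _ = (m : ℝ) * (A * X) + (∑ s ∈ Finset.range m, 1 / ((s : ℝ) + 1) ^ 2) * Y := hsum
    _ ≤ (m : ℝ) * A * X + 2 * Y := by nlinarith [mul_le_mul_of_nonneg_right hT2 hYnn]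


/-- ★★ **Window currency of §9.**  With tower levers `(ev_j − μ)² ≤ D²r²μ²` on `S`, tower weight `Σ_S w_j ≤ C_t·w_{j₀}` and hard weight
`‖x‖² − Σ_S w_j ≤ C_h·(m r²)·w_{j₀}`:  `defectSum β x m ≤ (A·D²·C_t + 2C_h)·(m r²)`.  At `m = dressSteps L = L`, `r = Λ/L` this is `m r² = Λ²/L`,
i.e. the normalisation of `DefectSumSmall` ∕ `DefectSumAt` (up to the order-one ratio `μ_{i+1}/μ₀`); `C_t` may be ANY window-uniform constant (one loop:
`O(λ²)`), `C_h·Λ²/L` is the hard sharp-time relative weight (true size `κλ⁴/L`, cdisprove (G1-d′)). [cite: LuscherWolff1990, §2] [cite: Kato1949, §1] -/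
theorem defectSum_le_of_tower_hard {β : ℝ} (hβ : 0 < β) {N : ℕ} {ψ : Fin N → (GaugeConfig 3 L SU2 → ℝ)} (hψ : ∀ j, IsPhys (ψ j))
    (hon : ∀ i l, l2 (ψ i) (ψ l) = if i = l then 1 else 0) (ev : Fin N → ℝ)
    (heig : ∀ j, transferApply β (ψ j) = ev j • ψ j) {Λ : ℝ} (hΛ : 0 ≤ Λ)
    (hdom : ∀ φ : GaugeConfig 3 L SU2 → ℝ, IsPhys φ → (∀ j, l2 φ (ψ j) = 0) → l2 φ (transferApply β φ) ≤ Λ * l2 φ φ)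
    {x : GaugeConfig 3 L SU2 → ℝ} (hx : IsPhys x) (j₀ : Fin N) (hμ : 0 < ev j₀) (hw0 : 0 < l2 x (ψ j₀) ^ 2) (hΛμ : Λ ≤ ev j₀)
    (S : Finset (Fin N)) (hS : ∀ j, j ∉ S → ev j ≤ ev j₀) (m : ℕ)
    (hgap : ∀ s : ℕ, s < m → ((s : ℝ) + 1) ^ 2 * Λ ^ (2 * s) ≤ ev j₀ ^ (2 * s))
    {A : ℝ} (hA : ∀ j ∈ S, ∀ s : ℕ, s < m → ev j ^ (2 * s) ≤ A * ev j₀ ^ (2 * s)) (hA0 : 0 ≤ A)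
    {D Ct Ch r : ℝ} (hlever : ∀ j ∈ S, (ev j - ev j₀) ^ 2 ≤ D ^ 2 * r ^ 2 * ev j₀ ^ 2)
    (htower : ∑ j ∈ S, l2 x (ψ j) ^ 2 ≤ Ct * l2 x (ψ j₀) ^ 2)
    (hhard : l2 x x - ∑ j ∈ S, l2 x (ψ j) ^ 2 ≤ Ch * ((m : ℝ) * r ^ 2) * l2 x (ψ j₀) ^ 2) :
    defectSum β x m ≤ (A * D ^ 2 * Ct + 2 * Ch) * ((m : ℝ) * r ^ 2) := by
  have h := defectSum_le_of_sharp_weights hβ hψ hon ev heig hΛ hdom hx j₀ hμ hw0 hΛμ S hS m hgap hA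
  have hμ2w : 0 < ev j₀ ^ 2 * l2 x (ψ j₀) ^ 2 := mul_pos (pow_pos hμ 2) hw0
  have hX : (∑ j ∈ S, (ev j - ev j₀) ^ 2 * l2 x (ψ j) ^ 2) / (ev j₀ ^ 2 * l2 x (ψ j₀) ^ 2) ≤ D ^ 2 * r ^ 2 * Ct := by
    rw [div_le_iff₀ hμ2w]
    calc ∑ j ∈ S, (ev j - ev j₀) ^ 2 * l2 x (ψ j) ^ 2 ≤ ∑ j ∈ S, D ^ 2 * r ^ 2 * ev j₀ ^ 2 * l2 x (ψ j) ^ 2 :=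
          Finset.sum_le_sum fun j hj => mul_le_mul_of_nonneg_right (hlever j hj) (sq_nonneg _)
      _ = D ^ 2 * r ^ 2 * ev j₀ ^ 2 * ∑ j ∈ S, l2 x (ψ j) ^ 2 := by rw [Finset.mul_sum]
      _ ≤ D ^ 2 * r ^ 2 * ev j₀ ^ 2 * (Ct * l2 x (ψ j₀) ^ 2) := mul_le_mul_of_nonneg_left htower (by positivity)
      _ = D ^ 2 * r ^ 2 * Ct * (ev j₀ ^ 2 * l2 x (ψ j₀) ^ 2) := by ring
  have hY : (l2 x x - ∑ j ∈ S, l2 x (ψ j) ^ 2) / l2 x (ψ j₀) ^ 2 ≤ Ch * ((m : ℝ) * r ^ 2) := by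
    rw [div_le_iff₀ hw0]; exact hhard
  have hm : (0 : ℝ) ≤ (m : ℝ) * A := by positivity
  calc defectSum β x m ≤ (m : ℝ) * A * ((∑ j ∈ S, (ev j - ev j₀) ^ 2 * l2 x (ψ j) ^ 2) / (ev j₀ ^ 2 * l2 x (ψ j₀) ^ 2)) +
        2 * ((l2 x x - ∑ j ∈ S, l2 x (ψ j) ^ 2) / l2 x (ψ j₀) ^ 2) := h
    _ ≤ (m : ℝ) * A * (D ^ 2 * r ^ 2 * Ct) + 2 * (Ch * ((m : ℝ) * r ^ 2)) :=
        add_le_add (mul_le_mul_of_nonneg_left hX hm) (by linarith)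
    _ = (A * D ^ 2 * Ct + 2 * Ch) * ((m : ℝ) * r ^ 2) := by ring


/-! ## §10 (rev 3) The same seams keyed to skeleton r6 («explicit transplanted observables», registered 2026-08-27T18:29Z) — parametric in the basis predicate

r6's `stub_universality := ∀ k, ChannelUniversalityForL (TransplantBasisL k)` (`…PolyakovLiftBasisGenericL`, p554440; `TransplantBasisL`, p554989).  Below, the
`P`-parametric forms of `ChannelUniversalitySharpAt` ∕ `DefectSumAt` ∕ `CouplingUniversalityAt` (`LiftBasis (liftCoupling β L) k ω g ↦ P L (luscherLambda β L) g`,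
exactly as the lead's `…ForL` texts), and ★★★ `channelUniversalityForL_of_sharp_defectSum_coupling (hP : BasisPhysL P) : SharpForL P → DefectSumForL P →
CouplingForL P → ChannelUniversalityForL P`; at `P := TransplantBasisL k` (`basisPhysL_transplantBasisL`) the conclusion is the registered stub body BY NAME
(`stub_universality_of_sharp_defectSum_coupling`).  Only `IsPhys (g i)` of the basis is used. -/

/-- **(A-sharp)_P** — the two-sided SHARP kick statistic for the basis predicate `P` (cf. `ChannelUniversalitySharpAt`). [cite: Luscher1983, §3] [cite: LuscherWolff1990, §2] -/
def ChannelUniversalitySharpForL {k : ℕ} (P : ℕ → ℝ → (Fin k → (GaugeConfig 3 1 SU2 → ℝ)) → Prop) : Prop :=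
  ∃ C lam0 : ℝ, 0 ≤ C ∧ 0 < lam0 ∧ ∀ lam : ℝ, 0 < lam → lam ≤ lam0 → ∃ L0 : ℕ,
    ∀ (L : ℕ) [NeZero L], L0 ≤ L → ∀ β : ℝ, InFemtoWindow lam β L →
      ∀ φ : GaugeConfig 3 L SU2 → ℝ, IsRawVacuum β φ →
        ∀ g : Fin k → (GaugeConfig 3 1 SU2 → ℝ), P L (luscherLambda β L) g →
          ∀ e₀ : GaugeConfig 3 1 SU2 → ℝ, IsRawVacuum (L := 1) (oneSiteCoupling β L) e₀ →
            let v := liftFamily β φ g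
            let w := shadowFamily (oneSiteCoupling β L) L e₀ g
            let l0 := levelValue su2Rep L β 0
            let m0 := levelValue su2Rep 1 (oneSiteCoupling β L) 0
            ∀ i : Fin k, 0 < l2 (v i) (v i) ∧
              l2 (v i) (transferApply β (v i)) * l2 (w i) (w i) * m0 ≤
                  Real.exp (C * luscherLambda β L ^ 2 / L) * (l2 (w i) (transferApply (oneSiteCoupling β L) (w i)) * l2 (v i) (v i) * l0) ∧
              l2 (w i) (transferApply (oneSiteCoupling β L) (w i)) * l2 (v i) (v i) * l0 ≤
                  Real.exp (C * luscherLambda β L ^ 2 / L) * (l2 (v i) (transferApply β (v i)) * l2 (w i) (w i) * m0)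

/-- **(A-profile)_P** — the integrated leakage profile bound for the basis predicate `P` (cf. `DefectSumAt`). [cite: LuscherWolff1990, §2] -/
def DefectSumForL {k : ℕ} (P : ℕ → ℝ → (Fin k → (GaugeConfig 3 1 SU2 → ℝ)) → Prop) : Prop :=
  ∃ C lam0 : ℝ, 0 ≤ C ∧ 0 < lam0 ∧ ∀ lam : ℝ, 0 < lam → lam ≤ lam0 → ∃ L0 : ℕ,
    ∀ (L : ℕ) [NeZero L], L0 ≤ L → ∀ β : ℝ, InFemtoWindow lam β L →
      ∀ φ : GaugeConfig 3 L SU2 → ℝ, IsRawVacuum β φ →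
        ∀ g : Fin k → (GaugeConfig 3 1 SU2 → ℝ), P L (luscherLambda β L) g →
          ∀ e₀ : GaugeConfig 3 1 SU2 → ℝ, IsRawVacuum (L := 1) (oneSiteCoupling β L) e₀ →
            let v := liftFamily β φ g
            let w := shadowFamily (oneSiteCoupling β L) L e₀ g
            let m0 := levelValue su2Rep 1 (oneSiteCoupling β L) 0
            ∀ i : Fin k, defectSum β (v i) (dressSteps L) * (l2 (w i) (w i) * m0) ≤
              C * (luscherLambda β L ^ 2 / L) * l2 (w i) (transferApply (oneSiteCoupling β L) (w i))

/-- **(A6′)_P** — the coupling conjunct of `ChannelUniversalityForL P`, verbatim. [cite: LuscherWolff1990, §2] -/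
def CouplingUniversalityForL {k : ℕ} (P : ℕ → ℝ → (Fin k → (GaugeConfig 3 1 SU2 → ℝ)) → Prop) : Prop :=
  ∃ C lam0 : ℝ, 0 ≤ C ∧ 0 < lam0 ∧ ∀ lam : ℝ, 0 < lam → lam ≤ lam0 → ∃ L0 : ℕ,
    ∀ (L : ℕ) [NeZero L], L0 ≤ L → ∀ β : ℝ, InFemtoWindow lam β L →
      ∀ φ : GaugeConfig 3 L SU2 → ℝ, IsRawVacuum β φ →
        ∀ g : Fin k → (GaugeConfig 3 1 SU2 → ℝ), P L (luscherLambda β L) g →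
          ∀ e₀ : GaugeConfig 3 1 SU2 → ℝ, IsRawVacuum (L := 1) (oneSiteCoupling β L) e₀ →
            let u := dressedLiftFamily β φ g
            let w := shadowFamily (oneSiteCoupling β L) L e₀ g
            let l0 := levelValue su2Rep L β 0
            let m0 := levelValue su2Rep 1 (oneSiteCoupling β L) 0
            ∀ i l : Fin k, i ≠ l →
              |(l2 (u i) (transferApply β (u l)) -
                  (l2 (u i) (transferApply β (u i)) / l2 (u i) (u i) + l2 (u l) (transferApply β (u l)) / l2 (u l) (u l)) / 2 *
                    l2 (u i) (u l)) * m0 * (Real.sqrt (l2 (w i) (w i)) * Real.sqrt (l2 (w l) (w l))) -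
                (l2 (w i) (transferApply (oneSiteCoupling β L) (w l)) -
                  (l2 (w i) (transferApply (oneSiteCoupling β L) (w i)) / l2 (w i) (w i) +
                      l2 (w l) (transferApply (oneSiteCoupling β L) (w l)) / l2 (w l) (w l)) / 2 * l2 (w i) (w l)) * l0 *
                  (Real.sqrt (l2 (u i) (u i)) * Real.sqrt (l2 (u l) (u l)))|
                ≤ C * (luscherLambda β L ^ 2 / L) * l0 * m0 *
                  (Real.sqrt (l2 (u i) (u i)) * Real.sqrt (l2 (u l) (u l))) * (Real.sqrt (l2 (w i) (w i)) * Real.sqrt (l2 (w l) (w l)))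

/-- ★★★ **S-UNIV′ (r6 currency) from SHARP + PROFILE + (A6′)**, parametric in the basis predicate: for any `P` with physical members,
`ChannelUniversalitySharpForL P → DefectSumForL P → CouplingUniversalityForL P → ChannelUniversalityForL P` (constant `C_S + 2C_D + C_6`).  The (A5).2
conjunct is transported from the sharp lift by monotone dressing (§2), the (A5).1 conjunct by the telescoped defect sandwich (§7), (A6′) is bumped.
[cite: ReedSimonIV1978, Thm. XIII.1] [cite: Luscher1983, §3] [cite: LuscherWolff1990, §2] -/
theorem channelUniversalityForL_of_sharp_defectSum_coupling {k : ℕ} {P : ℕ → ℝ → (Fin k → (GaugeConfig 3 1 SU2 → ℝ)) → Prop} (hP : BasisPhysL P)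
    (hS : ChannelUniversalitySharpForL P) (hD : DefectSumForL P) (h6 : CouplingUniversalityForL P) : ChannelUniversalityForL P := by
  obtain ⟨CS, lS, hCS, hlS, hSk⟩ := hS
  obtain ⟨CD, lD, hCD, hlD, hDk⟩ := hD
  obtain ⟨C6, l6, hC6, hl6, h6k⟩ := h6
  refine ⟨CS + 2 * CD + C6, min (min lS lD) l6, by positivity, lt_min (lt_min hlS hlD) hl6, fun lam hlam hle => ?_⟩
  obtain ⟨LS, hLS⟩ := hSk lam hlam (hle.trans ((min_le_left _ _).trans (min_le_left _ _)))
  obtain ⟨LD, hLD⟩ := hDk lam hlam (hle.trans ((min_le_left _ _).trans (min_le_right _ _)))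
  obtain ⟨L6, hL6⟩ := h6k lam hlam (hle.trans (min_le_right _ _))
  refine ⟨max (max LS LD) L6, fun L _ hL β hW φ hφ g hPg e₀ he₀ => ?_⟩
  have hS' := hLS L (((le_max_left _ _).trans (le_max_left _ _)).trans hL) β hW φ hφ g hPg e₀ he₀
  have hD' := hLD L (((le_max_right _ _).trans (le_max_left _ _)).trans hL) β hW φ hφ g hPg e₀ he₀
  have h6' := hL6 L ((le_max_right _ _).trans hL) β hW φ hφ g hPg e₀ he₀
  dsimp only at hS' hD' h6' ⊢
  -- positivity bookkeeping
  have hβpos : 0 < β := zero_lt_one.trans_le hW.1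
  have hΛpos : 0 < luscherLambda β L := luscherLambda_pos_of_window hlam hW
  have hLpos : (0 : ℝ) < L := Nat.cast_pos.mpr (NeZero.pos L)
  have hBpos : 0 < oneSiteCoupling β L := by
    unfold oneSiteCoupling; exact div_pos (mul_pos two_pos (pow_pos hLpos 3)) (pow_pos hΛpos 3)
  have hm0pos : 0 < levelValue su2Rep 1 (oneSiteCoupling β L) 0 := levelValue_su2Rep_pos (L := 1) hBpos 0
  have hl0nn : 0 ≤ levelValue su2Rep L β 0 := levelValue_su2Rep_nonneg L hβpos.le 0
  have hx : 0 ≤ luscherLambda β L ^ 2 / L := div_nonneg (sq_nonneg _) hLpos.le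
  have hg : ∀ i, IsPhys (g i) := hP L (luscherLambda β L) g hPg
  have hvP : ∀ i, IsPhys (liftFamily β φ g i) := fun i => isPhys_liftVec β hφ.1 (hg i)
  have huP : ∀ i, IsPhys (dressedLiftFamily β φ g i) := fun i => isPhys_dressedLiftVec β hφ.1 (hg i)
  have hdD : ∀ i, 0 ≤ l2 (dressedLiftFamily β φ g i) (transferApply β (dressedLiftFamily β φ g i)) := fun i => by
    rw [← qform_eq_l2_transferApply]; exact qform_su2Rep_self_nonneg hβpos.le (huP i)
  have eS : CS * luscherLambda β L ^ 2 / L = CS * (luscherLambda β L ^ 2 / L) := by ring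
  have eT : (CS + 2 * CD + C6) * luscherLambda β L ^ 2 / L =
      CS * (luscherLambda β L ^ 2 / L) + 2 * (CD * (luscherLambda β L ^ 2 / L)) + C6 * (luscherLambda β L ^ 2 / L) := by ring
  have hexpV : Real.exp (CS * luscherLambda β L ^ 2 / L) ≤ Real.exp ((CS + 2 * CD + C6) * luscherLambda β L ^ 2 / L) := by
    rw [eS, eT]; exact Real.exp_le_exp.mpr (by nlinarith [mul_nonneg hCD hx, mul_nonneg hC6 hx])
  have hexpA : Real.exp (CS * luscherLambda β L ^ 2 / L) + 2 * (CD * (luscherLambda β L ^ 2 / L)) ≤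
      Real.exp ((CS + 2 * CD + C6) * luscherLambda β L ^ 2 / L) := by
    calc Real.exp (CS * luscherLambda β L ^ 2 / L) + 2 * (CD * (luscherLambda β L ^ 2 / L))
        ≤ Real.exp (CS * luscherLambda β L ^ 2 / L + 2 * (CD * (luscherLambda β L ^ 2 / L))) :=
          exp_add_le_exp_add (by rw [eS]; exact mul_nonneg hCS hx) (by positivity)
      _ ≤ Real.exp ((CS + 2 * CD + C6) * luscherLambda β L ^ 2 / L) := by
          rw [eS, eT]; exact Real.exp_le_exp.mpr (le_add_of_nonneg_right (mul_nonneg hC6 hx))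
  refine ⟨fun i => ⟨?_, ?_⟩, fun i l hil => ?_⟩
  · -- (A5).1: dressed anti-variational half from the sharp one + the profile (telescoped sandwich)
    obtain ⟨hnv, hanti, -⟩ := hS' i
    have hun : 0 < l2 (dressedLiftFamily β φ g i) (dressedLiftFamily β φ g i) := by
      rw [dressedLiftFamily_apply]; exact l2_iterate_self_pos hβpos (hvP i) hnv (dressSteps L)
    have htel : l2 (dressedLiftFamily β φ g i) (transferApply β (dressedLiftFamily β φ g i)) /
          l2 (dressedLiftFamily β φ g i) (dressedLiftFamily β φ g i) ≤
        l2 (liftFamily β φ g i) (transferApply β (liftFamily β φ g i)) / l2 (liftFamily β φ g i) (liftFamily β φ g i) +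
          2 * levelValue su2Rep L β 0 * defectSum β (liftFamily β φ g i) (dressSteps L) := by
      have h := rayleigh_iterate_le_add_defectSum hβpos (hvP i) hnv (dressSteps L)
      unfold rayleigh at h
      simpa only [qform_eq_l2_transferApply, dressedLiftFamily_apply] using h
    have hdV : 0 ≤ l2 (liftFamily β φ g i) (transferApply β (liftFamily β φ g i)) := by
      rw [← qform_eq_l2_transferApply]; exact qform_su2Rep_self_nonneg hβpos.le (hvP i)
    exact a5anti_of_sharp_defectSum hnv hun (l2_self_nonneg _) hm0pos.le hdV (levelValue_su2Rep_pos hβpos 0) (Real.exp_pos _)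
      htel hanti (hD' i) hexpA
  · -- (A5).2: variational half, transported from the sharp lift by monotone dressing
    obtain ⟨hnv, -, hvar⟩ := hS' i
    have hmono := d_mul_n_le_iterate hβpos (hvP i) hnv (dressSteps L)
    rw [← dressedLiftFamily_apply] at hmono
    exact a5var_transfer hnv (l2_self_nonneg _) (l2_self_nonneg _) hm0pos.le (hdD i) (Real.exp_pos _).le hexpV hmono hvar
  · -- (A6′): constant bumped
    refine (h6' i l hil).trans ?_
    have hP0 : 0 ≤ (luscherLambda β L ^ 2 / L) * levelValue su2Rep L β 0 * levelValue su2Rep 1 (oneSiteCoupling β L) 0 *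
        (Real.sqrt (l2 (dressedLiftFamily β φ g i) (dressedLiftFamily β φ g i)) *
          Real.sqrt (l2 (dressedLiftFamily β φ g l) (dressedLiftFamily β φ g l))) *
        (Real.sqrt (l2 (shadowFamily (oneSiteCoupling β L) L e₀ g i) (shadowFamily (oneSiteCoupling β L) L e₀ g i)) *
          Real.sqrt (l2 (shadowFamily (oneSiteCoupling β L) L e₀ g l) (shadowFamily (oneSiteCoupling β L) L e₀ g l))) := by
      positivity
    nlinarith [mul_nonneg (add_nonneg hCS (mul_nonneg zero_le_two hCD)) hP0]

/-- ★★ **r6's registered `stub_universality` body from three inputs**: at `P := TransplantBasisL k` (root-transplanted AL1 eigen-ratios, `basisPhysL_transplantBasisL`),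
`(∀ k, SharpForL) → (∀ k, DefectSumForL) → (∀ k, CouplingForL) → ∀ k, ChannelUniversalityForL (TransplantBasisL k)` — the conclusion is
`Summit.QuantumFields.YangMills.Cruxes.DressedRitz.PolyakovLift.Stmt.stub_universality` of `Lines-polyakovlift-r6.lean` verbatim. [cite: Luscher1983, §3] -/
theorem stub_universality_of_sharp_defectSum_coupling (hS : ∀ k, ChannelUniversalitySharpForL (TransplantBasisL k))
    (hD : ∀ k, DefectSumForL (TransplantBasisL k)) (h6 : ∀ k, CouplingUniversalityForL (TransplantBasisL k)) :
    ∀ k, ChannelUniversalityForL (TransplantBasisL k) := fun k =>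
  channelUniversalityForL_of_sharp_defectSum_coupling (basisPhysL_transplantBasisL k) (hS k) (hD k) (h6 k)

end Summit.QuantumFields.YangMills.Cruxes.DressedRitz.KickDirichlet

end
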